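import Literature.NumberTheory.LFunctions.WeilCriterionConverse
import Literature.NumberTheory.LFunctions.LandauOscillation
import Literature.Analysis.Complex.BoundedPowerSums
import Literature.NumberTheory.LFunctions.WeilMellinBounds
import Literature.NumberTheory.LFunctions.WeilExplicitFormulaProofs
import Literature.NumberTheory.LFunctions.YoshidaOddCriterion
import Literature.NumberTheory.LFunctions.ZetaRealAxis
import Literature.NumberTheory.LFunctions.GeneralizedRH
import HarnessLib

/-!
# Yoshida's odd-sector Weil criterion (Yoshida 1992 Prop. 1(1), k = ℚ) — `yoshida_odd_criterion` HOLDS (re-homed proofs)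

**Yoshida's odd-sector form of Weil's criterion (Yoshida 1992 Prop. 1(1), case `k = ℚ`) — BOTH halves, hence the named
fact `Literature.NumberTheory.LFunctions.yoshida_odd_criterion` (`YoshidaOddCriterion.lean`) HOLDS**:
`RiemannHypothesis ↔ Re W(g ⋆ g̃) ≥ 0 for every odd test function g` (H. Yoshida, *On Hermitian forms attached to zeta
functions*, Adv. Stud. Pure Math. 21 (1992) 281–325, §1 Prop. 1(1) p. 285, proof pp. 286–287 [Yoshida1992HermitianForms];
the machinery is Bombieri's proof of the converse of Weil's criterion, E. Bombieri, Rend. Lincei (9) 11 (2000) §3 Thm. 1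
[Bombieri2000Weil], with the two-sided bounded-power-sum lemma replaced by a ONE-SIDED power-sum lemma proved from
Landau's theorem [MontgomeryVaughan2007, §15.1 Lemma 15.1]).  Contents: symmetric translates and their zero-side form
`Q₀(h_x) = (Re B_g(2x) + Q₀(g))/2`; the exponential series `B_g` over the zeros under reflection; the Landau transform of a
bounded-below exponential sum and the one-sided power-sum lemma (no mode of positive real part); an even real test with
`ĝ(ρ) ≠ 0`; the engine applied to `B_g`; the odd-sector criterion (odd real positivity ⟹ every non-real zero of the strip
is on the line); and Prop. 1(1): `oddPositivity_iff_riemannHypothesis`, `yoshida_odd_criterion_holds` (EXACT name).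
RE-HOMED into `Literature/` by the Hodge foundations lane (`lit-hodgefound`, seat p20, generation 37): verbatim
DECLARATION-LEVEL ports (the declarations needed, in dependency order, each Part with a route-neutralised module docstring)
of `Summits/RiemannHypothesis/RiemannHypothesis/Theorems/{RuelleBandExactFirstBandStubEvenSymTranslate (7 declarations),
…StubEvenExpSum (2), …StubEvenEngineTransform (15), …StubEvenEngine (1), …StubEvenTestExists (2), …StubEvenTransfer (1),
…StubOddSectorCriterion (11), OddBartaFloor/Negative/OddBartaFloorLoadBearing (2)}.lean`, namespace
`Summit.RiemannHypothesis.RiemannHypothesis.Theorems.RuelleBandExactFirstBand` re-rooted as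
`Literature.NumberTheory.LFunctions.WeilOddSector` and `…Theorems.OddBartaFloor.Negative` as `Literature.NumberTheory.LFunctions`
(the in-tree `stub_…` theorem names are kept so that twins have the same short names; they are proved theorems, not stubs).
Built on the tree's Literature layer `Literature/NumberTheory/LFunctions/` (`WeilCriterionConverse`, `WeilExplicitFormulaProofs`
— `explicit_formula_holds` —, `WeilMellinBounds`, `LandauOscillation`, `ZetaRealAxis`, `GeneralizedRH`, `YoshidaOddCriterion`)
and `Literature/Analysis/Complex/BoundedPowerSums.lean`.  Theorem-only file: no definition, no new named fact (D-0026); imports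
Mathlib/Literature only; every declaration carries the citation of the printed statement it formalises or serves.  The Summits
originals stay in place (transitional duplication).  WHAT THIS IS NOT: every statement here is an EQUIVALENT reformulation of
RH or a lemma of analysis; nothing here bears on the truth of the Riemann Hypothesis.
-/

noncomputable section

/-!
## Part 1 — port of `Summits/RiemannHypothesis/RiemannHypothesis/Theorems/RuelleBandExactFirstBandStubEvenSymTranslate.lean` (7 declarations kept)

# Symmetric translates of a test function and their zero-side Weil form

For a test function `g` (`IsWeilTest`) and a real `x`, the symmetric translate
`h_x(t) = (g(t − x) + g(t + x)) / 2`
* is again a test function (`h_x = ½ (g_x + g_{−x})`, `g_x = weilTranslate g x`), real-valued whenever `g` is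
  (`symTranslate_im`);
* has transform `ĥ_x(s) = ĝ(s) · (e^{(s − 1/2) x} + e^{−(s − 1/2) x}) / 2` (`weilMellin_symTranslate`), zero-side pairing
  `P_{h_x}(ρ) = P_g(ρ) · ((E + E⁻¹)/2)²`, `E = e^{(ρ − 1/2) x}` (`pairCoeff_symTranslate`);
* has zero-side Weil form `Q₀(h_x) = (Re B_g(2x) + Q₀(g)) / 2` (`zeroForm_symTranslate`), where `Q₀ = WeilConverse.zeroForm`
  and `B_g = WeilConverse.expSum g = Σ_ρ m(ρ) P_g(ρ) e^{(ρ − 1/2) x}` is the exponential series over the non-trivial zeros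
  (tree, `Literature/NumberTheory/LFunctions/WeilCriterionConverse.lean`; `expSum'_eq_conj_expSum`).

The symmetric analogue of the tree's polarisation identity `WeilConverse.zeroForm_translateMix` (Bombieri's dipoles
`g + c·g(· − x)`).  Reference: E. Bombieri, *Remarks on Weil's quadratic functional in the theory of prime numbers I*,
Rend. Lincei (9) 11 (2000) 183–233, §3, proof of Thm. 1 [Bombieri2000Weil].
-/

section Part1

open _root_.Complex _root_.MeasureTheory _root_.Filter _root_.Set
open scoped _root_.Real _root_.Topology ComplexConjugate

namespace Literature.NumberTheory.LFunctions.WeilOddSector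

open Literature.NumberTheory.LFunctions

/-- The symmetric translate is half the sum of the two translates `g_x`, `g_{-x}`
(`weilTranslate g x t = g (t - x)`, and `t + x = t - (-x)`).
[cite: Bombieri2000Weil, §3 Thm. 1 (proof: translates of a test function and the polarisation of the zero-side form; symmetric variant)] -/
theorem symTranslate_eq_weilTranslate (g : ℝ → ℂ) (x : ℝ) :
    (fun t : ℝ => (g (t - x) + g (t + x)) / 2) =
      fun t : ℝ => (1 / 2 : ℂ) * (weilTranslate g x + weilTranslate g (-x)) t := by
  funext t
  simp only [Pi.add_apply, weilTranslate, sub_neg_eq_add]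
  ring

/-- The symmetric translate of a test function is a test function.
[cite: Bombieri2000Weil, §3 Thm. 1 (proof: translates of a test function and the polarisation of the zero-side form; symmetric variant)] -/
theorem isWeilTest_symTranslate {g : ℝ → ℂ} (hg : IsWeilTest g) (x : ℝ) :
    IsWeilTest (fun t : ℝ => (g (t - x) + g (t + x)) / 2) := by
  rw [symTranslate_eq_weilTranslate]
  exact ((hg.weilTranslate x).add (hg.weilTranslate (-x))).const_mul (1 / 2)

/-- The symmetric translate of a real-valued function is real-valued.
[cite: Bombieri2000Weil, §3 Thm. 1 (proof: translates of a test function and the polarisation of the zero-side form; symmetric variant)] -/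
theorem symTranslate_im {g : ℝ → ℂ} (hr : ∀ t : ℝ, (g t).im = 0) (x t : ℝ) :
    ((g (t - x) + g (t + x)) / 2).im = 0 := by
  rw [Complex.div_ofNat_im, Complex.add_im, hr, hr, add_zero, zero_div]

/-- Transform of the symmetric translate: `ĥ_x(s) = ĝ(s) · (e^{(s-1/2)x} + e^{-(s-1/2)x}) / 2`
(linearity and `weilMellin_weilTranslate`).
[cite: Bombieri2000Weil, §3 Thm. 1 (proof: translates of a test function and the polarisation of the zero-side form; symmetric variant)] -/
theorem weilMellin_symTranslate {g : ℝ → ℂ} (hg : IsWeilTest g) (x : ℝ) (s : ℂ) :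
    weilMellin (fun t : ℝ => (g (t - x) + g (t + x)) / 2) s =
      weilMellin g s * ((cexp ((s - 1 / 2) * x) + cexp (-((s - 1 / 2) * x))) / 2) := by
  have h1 : IsWeilTest (weilTranslate g x) := hg.weilTranslate x
  have h2 : IsWeilTest (weilTranslate g (-x)) := hg.weilTranslate (-x)
  rw [symTranslate_eq_weilTranslate, weilMellin_const_mul,
    weilMellin_add h1.1.continuous h1.2 h2.1.continuous h2.2, weilMellin_weilTranslate,
    weilMellin_weilTranslate,
    show (s - 1 / 2) * (((-x : ℝ) : ℂ)) = -((s - 1 / 2) * (x : ℂ)) by push_cast; ring]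
  ring

/-- Termwise zero-side coefficient of the symmetric translate:
`P_{h_x}(ρ) = P_g(ρ) · (e^{(ρ-1/2)·2x} + e^{(1/2-ρ)·2x} + 2) / 4` (the conjugate of the transform factor at
`1 - ρ̄` is the same factor because `x` is real, and `e^{(ρ-1/2)x} e^{-(ρ-1/2)x} = 1`).
[cite: Bombieri2000Weil, §3 Thm. 1 (proof: translates of a test function and the polarisation of the zero-side form; symmetric variant)] -/
theorem pairCoeff_symTranslate {g : ℝ → ℂ} (hg : IsWeilTest g) (x : ℝ) (ρ : ℂ) :
    WeilConverse.pairCoeff (fun t : ℝ => (g (t - x) + g (t + x)) / 2) ρ =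
      WeilConverse.pairCoeff g ρ *
        ((cexp ((ρ - 1 / 2) * ((2 * x : ℝ) : ℂ)) + cexp ((1 / 2 - ρ) * ((2 * x : ℝ) : ℂ)) + 2) / 4) := by
  have hE2 : cexp ((ρ - 1 / 2) * x) * cexp ((ρ - 1 / 2) * x) = cexp ((ρ - 1 / 2) * ((2 * x : ℝ) : ℂ)) := by
    rw [← Complex.exp_add]
    congr 1
    push_cast
    ring
  have hE'2 : cexp (-((ρ - 1 / 2) * x)) * cexp (-((ρ - 1 / 2) * x)) =
      cexp ((1 / 2 - ρ) * ((2 * x : ℝ) : ℂ)) := by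
    rw [← Complex.exp_add]
    congr 1
    push_cast
    ring
  have hEE' : cexp ((ρ - 1 / 2) * x) * cexp (-((ρ - 1 / 2) * x)) = 1 := by
    rw [← Complex.exp_add, ← Complex.exp_zero]
    congr 1
    ring
  have hF : conj (cexp ((1 - conj ρ - 1 / 2) * x)) = cexp (-((ρ - 1 / 2) * x)) := by
    rw [← Complex.exp_conj]
    congr 1
    simp only [map_mul, map_sub, map_one, map_div₀, map_ofNat, Complex.conj_conj,
      Complex.conj_ofReal]
    ring
  have hF' : conj (cexp (-((1 - conj ρ - 1 / 2) * x))) = cexp ((ρ - 1 / 2) * x) := by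
    rw [← Complex.exp_conj]
    congr 1
    simp only [map_neg, map_mul, map_sub, map_one, map_div₀, map_ofNat, Complex.conj_conj,
      Complex.conj_ofReal]
    ring
  rw [WeilConverse.pairCoeff, WeilConverse.pairCoeff, weilMellin_symTranslate hg,
    weilMellin_symTranslate hg, map_mul, map_div₀, map_add, hF, hF', map_ofNat]
  linear_combination
    weilMellin g ρ * conj (weilMellin g (1 - conj ρ)) / 4 * (hE2 + hE'2 + 2 * hEE')

/-- `A_g = conj ∘ B_g` (from `conj A_g = B_g`, `WeilConverse.conj_expSum'`).
[cite: Bombieri2000Weil, §3 Thm. 1 (proof: translates of a test function and the polarisation of the zero-side form; symmetric variant)] -/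
theorem expSum'_eq_conj_expSum (g : ℝ → ℂ) (y : ℝ) :
    WeilConverse.expSum' g y = conj (WeilConverse.expSum g y) := by
  rw [← WeilConverse.conj_expSum' g y, Complex.conj_conj]

/-- Zero-side Weil form of the symmetric translate: `Q(h_x) = (Re B_g(2x) + Q(g)) / 2` (sum the termwise
identity `pairCoeff_symTranslate` against the absolutely convergent series `B_g(2x)`, `A_g(2x)`, `Q(g)`, and
use `B_g + A_g = B_g + conj B_g = 2 Re B_g`).
[cite: Bombieri2000Weil, §3 Thm. 1 (proof: translates of a test function and the polarisation of the zero-side form; symmetric variant)] -/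
theorem zeroForm_symTranslate {g : ℝ → ℂ} (hg : IsWeilTest g) (x : ℝ) :
    WeilConverse.zeroForm (fun t : ℝ => (g (t - x) + g (t + x)) / 2) =
      ((((WeilConverse.expSum g (2 * x)).re : ℝ) : ℂ) + WeilConverse.zeroForm g) / 2 := by
  have hP := (WeilConverse.summable_pairCoeff hg).hasSum
  have hA := (WeilConverse.summable_expSum' hg (2 * x)).hasSum
  have hB := (WeilConverse.summable_expSum hg (2 * x)).hasSum
  have h := ((hB.add hA).add (hP.mul_left 2)).div_const 4
  have hre : (((WeilConverse.expSum g (2 * x)).re : ℝ) : ℂ) =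
      (WeilConverse.expSum g (2 * x) + WeilConverse.expSum' g (2 * x)) / 2 := by
    rw [expSum'_eq_conj_expSum, Complex.add_conj]
    push_cast
    ring
  rw [hre, WeilConverse.zeroForm]
  refine Eq.trans (tsum_congr fun ρ ↦ ?_) (h.tsum_eq.trans ?_)
  · rw [pairCoeff_symTranslate hg]
    ring
  · show (WeilConverse.expSum g (2 * x) + WeilConverse.expSum' g (2 * x) +
        2 * WeilConverse.zeroForm g) / 4 = _
    ring

end Literature.NumberTheory.LFunctions.WeilOddSector

end Part1

/-!
## Part 2 — port of `Summits/RiemannHypothesis/RiemannHypothesis/Theorems/RuelleBandExactFirstBandStubEvenExpSum.lean` (2 declarations kept)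

# The exponential series over the zeros under the reflection `y ↦ −y` (two lemmas)

`expSum'_eq_expSum_neg`: `A_g(y) = B_g(−y)` termwise (`e^{(1/2 − ρ) y} = e^{(ρ − 1/2)(−y)}`), and
`conj_expSum_eq_expSum_neg`: `conj B_g(y) = B_g(−y)` (`WeilConverse.conj_expSum'`), for the generalised Dirichlet series
`B_g = WeilConverse.expSum g`, `A_g = WeilConverse.expSum' g` of a test function `g`.  Reference: [Bombieri2000Weil, §3
(proof of Thm. 1)].
-/

section Part2

open _root_.Complex _root_.MeasureTheory _root_.Filter _root_.Set
open scoped _root_.Real _root_.Topology ComplexConjugate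
namespace Literature.NumberTheory.LFunctions.WeilOddSector
open Literature.NumberTheory.LFunctions

/-- `A_g(y) = B_g(-y)` termwise: `e^{(1/2-ρ)y} = e^{(ρ-1/2)(-y)}` (no hypothesis on `g`).
[cite: Bombieri2000Weil, §3 Thm. 1 (proof: the exponential series over the zeros; symmetry ρ ↦ 1 − ρ)] -/
theorem expSum'_eq_expSum_neg (g : ℝ → ℂ) (y : ℝ) :
    WeilConverse.expSum' g y = WeilConverse.expSum g (-y) := by
  rw [WeilConverse.expSum', WeilConverse.expSum]
  refine tsum_congr fun ρ ↦ ?_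
  congr 2
  push_cast
  ring

/-- `conj B_g(y) = B_g(-y)` for every `g` (`conj_expSum'` conjugated, then `expSum'_eq_expSum_neg`).
[cite: Bombieri2000Weil, §3 Thm. 1 (proof: the exponential series over the zeros; symmetry ρ ↦ 1 − ρ)] -/
theorem conj_expSum_eq_expSum_neg (g : ℝ → ℂ) (y : ℝ) :
    conj (WeilConverse.expSum g y) = WeilConverse.expSum g (-y) := by
  rw [← WeilConverse.conj_expSum' g y, Complex.conj_conj, expSum'_eq_expSum_neg]

end Literature.NumberTheory.LFunctions.WeilOddSector

end Part2

/-!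
## Part 3 — port of `Summits/RiemannHypothesis/RiemannHypothesis/Theorems/RuelleBandExactFirstBandStubEvenEngineTransform.lean` (15 declarations kept)

# The Landau transform of a bounded-below exponential sum (analytic half of the one-sided power-sum lemma)

For a real exponential sum `F(x) = Σᵢ cᵢ e^{λᵢ x}` over a countable index type (`Σ‖cᵢ‖ < ∞`, `Re λᵢ ≤ R`, `(λᵢ)` locally
finite, no `λᵢ` on the open positive real axis) with `F ≥ −M` on `x ≥ 0`, the transform
`𝓜(s) = ∫₁^∞ (F(log y) + M) y^{−s−1} dy` of the NON-NEGATIVE function `y ↦ F(log y) + M` equals `Σᵢ cᵢ/(s − λᵢ) + M/s` for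
`Re s > R` and is holomorphic on all of `Re s > 0` by LANDAU'S THEOREM (tree, PROVED:
`Literature/NumberTheory/LFunctions/LandauOscillation.lean`, `Landau.integrableOn_of_differentiableOn_union_convex`): the
right-hand side is holomorphic on a thin box around the real segment `(0, R + 2]` because no `λᵢ` is a positive real.  Main
theorem `stub_evenEngine_transform` (the historical name of the in-tree original is kept); lemmas `evenEngine_*` (termwise
bounds, summability, continuity, the integrand identity, `∫₁^∞ y^{λ−s−1} dy = 1/(s − λ)`, the `HasSum` of the transform,
differentiability of the partial fractions).

References: H. L. Montgomery, R. C. Vaughan, *Multiplicative Number Theory I*, CUP 2007, §15.1 Lemma 15.1 (Landau)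
[MontgomeryVaughan2007]; the bounded two-sided version is the tree's `Literature/Analysis/Complex/BoundedPowerSums.lean`.
-/

section Part3

open _root_.Complex _root_.Filter _root_.Set _root_.MeasureTheory _root_.Metric
open scoped _root_.Real _root_.Topology

namespace Literature.NumberTheory.LFunctions.WeilOddSector

open Literature.NumberTheory.LFunctions
open Literature.Analysis.Complex

section Transform

variable {ι : Type} {c lam : ι → ℂ} {R M : ℝ}

/-- Norm of a term: `‖cᵢ e^{λᵢ x}‖ = ‖cᵢ‖ e^{(Re λᵢ) x}` for real `x`. [cite: MontgomeryVaughan2007, §15.1 Lemma 15.1 (Landau’s theorem for the Mellin transform of a non-negative function; applied to a bounded-below exponential sum)] -/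
theorem evenEngine_norm_term (i : ι) (x : ℝ) :
    ‖c i * cexp (lam i * x)‖ = ‖c i‖ * Real.exp ((lam i).re * x) := by
  rw [norm_mul, Complex.norm_exp]
  congr 2
  simp [Complex.mul_re]

/-- On `0 ≤ x ≤ X` the terms are bounded by `‖cᵢ‖ e^{R X}` (`R ≥ 0`, `Re λᵢ ≤ R`). [cite: MontgomeryVaughan2007, §15.1 Lemma 15.1 (Landau’s theorem for the Mellin transform of a non-negative function; applied to a bounded-below exponential sum)] -/
theorem evenEngine_norm_term_le (hR : ∀ i, (lam i).re ≤ R) (hR0 : 0 ≤ R) {X x : ℝ}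
    (hx0 : 0 ≤ x) (hxX : x ≤ X) (i : ι) :
    ‖c i * cexp (lam i * x)‖ ≤ ‖c i‖ * Real.exp (R * X) := by
  rw [evenEngine_norm_term]
  refine mul_le_mul_of_nonneg_left (Real.exp_le_exp.2 ?_) (norm_nonneg _)
  calc (lam i).re * x ≤ R * x := mul_le_mul_of_nonneg_right (hR i) hx0
    _ ≤ R * X := mul_le_mul_of_nonneg_left hxX hR0

/-- The norms of the terms are summable for `x ≥ 0`. [cite: MontgomeryVaughan2007, §15.1 Lemma 15.1 (Landau’s theorem for the Mellin transform of a non-negative function; applied to a bounded-below exponential sum)] -/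
theorem evenEngine_summable_norm (hc : Summable fun i ↦ ‖c i‖) (hR : ∀ i, (lam i).re ≤ R)
    (hR0 : 0 ≤ R) {x : ℝ} (hx : 0 ≤ x) :
    Summable fun i ↦ ‖c i * cexp (lam i * x)‖ :=
  Summable.of_nonneg_of_le (fun _ ↦ norm_nonneg _) (fun i ↦ evenEngine_norm_term_le hR hR0 hx le_rfl i)
    (hc.mul_right _)

/-- `‖F(x)‖ ≤ (Σ ‖cᵢ‖) e^{R x}` for `x ≥ 0`. [cite: MontgomeryVaughan2007, §15.1 Lemma 15.1 (Landau’s theorem for the Mellin transform of a non-negative function; applied to a bounded-below exponential sum)] -/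
theorem evenEngine_norm_tsum_le (hc : Summable fun i ↦ ‖c i‖) (hR : ∀ i, (lam i).re ≤ R)
    (hR0 : 0 ≤ R) {x : ℝ} (hx : 0 ≤ x) :
    ‖∑' i, c i * cexp (lam i * x)‖ ≤ (∑' i, ‖c i‖) * Real.exp (R * x) := by
  calc ‖∑' i, c i * cexp (lam i * x)‖ ≤ ∑' i, ‖c i * cexp (lam i * x)‖ :=
        norm_tsum_le_tsum_norm (evenEngine_summable_norm hc hR hR0 hx)
    _ ≤ ∑' i, ‖c i‖ * Real.exp (R * x) :=
        (evenEngine_summable_norm hc hR hR0 hx).tsum_le_tsum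
          (fun i ↦ evenEngine_norm_term_le hR hR0 hx le_rfl i) (hc.mul_right _)
    _ = (∑' i, ‖c i‖) * Real.exp (R * x) := tsum_mul_right

/-- `F` is continuous on `[0, ∞)` (locally uniform convergence). [cite: MontgomeryVaughan2007, §15.1 Lemma 15.1 (Landau’s theorem for the Mellin transform of a non-negative function; applied to a bounded-below exponential sum)] -/
theorem evenEngine_continuousOn (hc : Summable fun i ↦ ‖c i‖) (hR : ∀ i, (lam i).re ≤ R)
    (hR0 : 0 ≤ R) : ContinuousOn (fun x : ℝ ↦ ∑' i, c i * cexp (lam i * x)) (Ici 0) := by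
  intro x₀ hx₀
  have hcont : ContinuousOn (fun x : ℝ ↦ ∑' i, c i * cexp (lam i * x)) (Icc 0 (x₀ + 1)) :=
    continuousOn_tsum (fun i ↦ (by fun_prop : Continuous fun x : ℝ ↦ c i * cexp (lam i * x)).continuousOn)
      (hc.mul_right _) fun i x hx ↦ evenEngine_norm_term_le hR hR0 hx.1 hx.2 i
  have hmem : Icc 0 (x₀ + 1) ∈ 𝓝[Ici 0] x₀ := by
    refine mem_nhdsWithin.2 ⟨Iio (x₀ + 1), isOpen_Iio, by simp, fun x hx ↦ ⟨hx.2, le_of_lt hx.1⟩⟩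
  exact (hcont.continuousWithinAt ⟨hx₀, by linarith⟩).mono_of_mem_nhdsWithin hmem

/-- `g` is continuous (hence measurable). [cite: MontgomeryVaughan2007, §15.1 Lemma 15.1 (Landau’s theorem for the Mellin transform of a non-negative function; applied to a bounded-below exponential sum)] -/
theorem evenEngine_continuous_g (hc : Summable fun i ↦ ‖c i‖) (hR : ∀ i, (lam i).re ≤ R)
    (hR0 : 0 ≤ R) :
    Continuous fun y : ℝ ↦
      (∑' i, c i * cexp (lam i * ((Real.log (max y 1) : ℝ) : ℂ))).re + M := by
  have hlog : Continuous fun y : ℝ ↦ Real.log (max y 1) :=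
    (continuous_id.max continuous_const).log fun y ↦ by positivity
  exact (Complex.continuous_re.comp ((evenEngine_continuousOn hc hR hR0).comp_continuous hlog
    fun y ↦ Real.log_nonneg (le_max_right _ _))).add continuous_const

/-- For `y > 1`: `max y 1 = y` and `log y ≥ 0`. [cite: MontgomeryVaughan2007, §15.1 Lemma 15.1 (Landau’s theorem for the Mellin transform of a non-negative function; applied to a bounded-below exponential sum)] -/
theorem evenEngine_log_max {y : ℝ} (hy : 1 < y) : Real.log (max y 1) = Real.log y ∧ 0 ≤ Real.log y :=
  ⟨by rw [max_eq_left hy.le], Real.log_nonneg hy.le⟩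

/-- `g ≥ 0` everywhere when `Re F ≥ -M` on `[0, ∞)` (`log (max y 1) ≥ 0`). [cite: MontgomeryVaughan2007, §15.1 Lemma 15.1 (Landau’s theorem for the Mellin transform of a non-negative function; applied to a bounded-below exponential sum)] -/
theorem evenEngine_g_nonneg (hM : ∀ x : ℝ, 0 ≤ x → -M ≤ (∑' i, c i * cexp (lam i * x)).re) (y : ℝ) :
    0 ≤ (∑' i, c i * cexp (lam i * ((Real.log (max y 1) : ℝ) : ℂ))).re + M := by
  linarith [hM (Real.log (max y 1)) (Real.log_nonneg (le_max_right _ _))]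

/-- Growth of `g`: `|g(y)| ≤ (Σ‖cᵢ‖) y^R + |M|` for `y > 1`. [cite: MontgomeryVaughan2007, §15.1 Lemma 15.1 (Landau’s theorem for the Mellin transform of a non-negative function; applied to a bounded-below exponential sum)] -/
theorem evenEngine_abs_g_le (hc : Summable fun i ↦ ‖c i‖) (hR : ∀ i, (lam i).re ≤ R)
    (hR0 : 0 ≤ R) {y : ℝ} (hy : 1 < y) :
    |(∑' i, c i * cexp (lam i * ((Real.log (max y 1) : ℝ) : ℂ))).re + M| ≤
      (∑' i, ‖c i‖) * y ^ R + |M| := by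
  have hy0 : 0 < y := zero_lt_one.trans hy
  rw [(evenEngine_log_max hy).1]
  have h1 : |(∑' i, c i * cexp (lam i * ((Real.log y : ℝ) : ℂ))).re| ≤ (∑' i, ‖c i‖) * y ^ R := by
    refine (Complex.abs_re_le_norm _).trans ?_
    have h := evenEngine_norm_tsum_le hc hR hR0 (evenEngine_log_max hy).2 (c := c) (lam := lam)
    rwa [Real.rpow_def_of_pos hy0, mul_comm (Real.log y)]
  exact (abs_add_le _ _).trans (add_le_add h1 le_rfl)

/-- Absolute convergence of the transform at every `σ₁ > R`: `∫₁^∞ |g| y^{-(σ₁+1)} dy < ∞`. [cite: MontgomeryVaughan2007, §15.1 Lemma 15.1 (Landau’s theorem for the Mellin transform of a non-negative function; applied to a bounded-below exponential sum)] -/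
theorem evenEngine_hint (hc : Summable fun i ↦ ‖c i‖) (hR : ∀ i, (lam i).re ≤ R) (hR0 : 0 ≤ R)
    {σ₁ : ℝ} (hσ : R < σ₁) :
    IntegrableOn (fun y : ℝ ↦
      ((∑' i, c i * cexp (lam i * ((Real.log (max y 1) : ℝ) : ℂ))).re + M) * y ^ (-(σ₁ + 1)))
      (Ioi 1) := by
  set C : ℝ := (∑' i, ‖c i‖) + |M| with hC
  have hdom : IntegrableOn (fun y : ℝ ↦ C * y ^ (R - σ₁ - 1)) (Ioi 1) :=
    (integrableOn_Ioi_rpow_of_lt (by linarith) zero_lt_one).const_mul C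
  refine Integrable.mono' hdom ?_ ?_
  · refine ContinuousOn.aestronglyMeasurable (fun y hy ↦ ?_) measurableSet_Ioi
    have hy0 : 0 < y := zero_lt_one.trans hy
    exact (((evenEngine_continuous_g hc hR hR0 (M := M)).continuousAt).mul
      (Real.continuousAt_rpow_const _ _ (Or.inl hy0.ne'))).continuousWithinAt
  · rw [ae_restrict_iff' measurableSet_Ioi]
    refine Eventually.of_forall fun y hy ↦ ?_
    have hy0 : 0 < y := zero_lt_one.trans hy
    have hy1 : 1 ≤ y := le_of_lt hy
    rw [Real.norm_eq_abs, abs_mul, abs_of_pos (Real.rpow_pos_of_pos hy0 _)]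
    have hg := evenEngine_abs_g_le hc hR hR0 hy (M := M)
    have hpow : y ^ R * y ^ (-(σ₁ + 1)) = y ^ (R - σ₁ - 1) := by
      rw [← Real.rpow_add hy0]; ring_nf
    have hle : y ^ (-(σ₁ + 1)) ≤ y ^ (R - σ₁ - 1) :=
      Real.rpow_le_rpow_of_exponent_le hy1 (by linarith)
    have h2 : 0 ≤ y ^ (-(σ₁ + 1)) := Real.rpow_nonneg hy0.le _
    calc |(∑' i, c i * cexp (lam i * ((Real.log (max y 1) : ℝ) : ℂ))).re + M| * y ^ (-(σ₁ + 1))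
        ≤ ((∑' i, ‖c i‖) * y ^ R + |M|) * y ^ (-(σ₁ + 1)) :=
          mul_le_mul_of_nonneg_right hg h2
      _ = (∑' i, ‖c i‖) * (y ^ R * y ^ (-(σ₁ + 1))) + |M| * y ^ (-(σ₁ + 1)) := by ring
      _ ≤ (∑' i, ‖c i‖) * y ^ (R - σ₁ - 1) + |M| * y ^ (R - σ₁ - 1) := by
          rw [hpow]
          exact add_le_add le_rfl (mul_le_mul_of_nonneg_left hle (abs_nonneg M))
      _ = C * y ^ (R - σ₁ - 1) := by rw [hC]; ring

/-- For `y > 1` the integrand of the transform is `Σᵢ cᵢ y^{λᵢ-(s+1)} + M y^{-(s+1)}`. [cite: MontgomeryVaughan2007, §15.1 Lemma 15.1 (Landau’s theorem for the Mellin transform of a non-negative function; applied to a bounded-below exponential sum)] -/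
theorem evenEngine_integrand_eq
    (hreal : ∀ x : ℝ, 0 ≤ x → (∑' i, c i * cexp (lam i * x)).im = 0) {y : ℝ} (hy : 1 < y) (s : ℂ) :
    ((((∑' i, c i * cexp (lam i * ((Real.log (max y 1) : ℝ) : ℂ))).re + M : ℝ)) : ℂ) *
        (y : ℂ) ^ (-(s + 1)) =
      (∑' i, c i * (y : ℂ) ^ (lam i - (s + 1))) + (M : ℂ) * (y : ℂ) ^ (-(s + 1)) := by
  have hy0 : 0 < y := zero_lt_one.trans hy
  have hyC : (y : ℂ) ≠ 0 := by exact_mod_cast hy0.ne'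
  rw [(evenEngine_log_max hy).1]
  have hF : ((((∑' i, c i * cexp (lam i * ((Real.log y : ℝ) : ℂ))).re : ℝ)) : ℂ) =
      ∑' i, c i * cexp (lam i * ((Real.log y : ℝ) : ℂ)) := by
    apply Complex.ext
    · simp
    · rw [ofReal_im, hreal _ (evenEngine_log_max hy).2]
  have hterm : ∀ i, c i * cexp (lam i * ((Real.log y : ℝ) : ℂ)) * (y : ℂ) ^ (-(s + 1)) =
      c i * (y : ℂ) ^ (lam i - (s + 1)) := by
    intro i
    have h1 : cexp (lam i * ((Real.log y : ℝ) : ℂ)) = (y : ℂ) ^ (lam i) := by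
      rw [Complex.ofReal_log hy0.le, Complex.cpow_def_of_ne_zero hyC, mul_comm]
    rw [mul_assoc, h1, ← Complex.cpow_add _ _ hyC, sub_eq_add_neg]
  push_cast
  rw [hF, add_mul, ← tsum_mul_right]
  exact congrArg (· + (M : ℂ) * (y : ℂ) ^ (-(s + 1))) (tsum_congr hterm)

/-- `∫₁^∞ t^a dt = -1/(a+1)` for `Re a < -1` (complex power). [cite: MontgomeryVaughan2007, §15.1 Lemma 15.1 (Landau’s theorem for the Mellin transform of a non-negative function; applied to a bounded-below exponential sum)] -/
theorem evenEngine_integral_cpow {a : ℂ} (ha : a.re < -1) :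
    ∫ t : ℝ in Ioi 1, (t : ℂ) ^ a = -1 / (a + 1) := by
  rw [integral_Ioi_cpow_of_lt ha zero_lt_one, Complex.ofReal_one, Complex.one_cpow]

/-- **The transform on `Re s > R`**: `HasSum (cᵢ/(s-λᵢ)) (𝓜(s) - M/s)`, `𝓜 = Landau.mellinIoi g`,
`g(y) = Re F(log (max y 1)) + M` (termwise integrals, dominated interchange, `∫₁^∞ M y^{-s-1} = M/s`). [cite: MontgomeryVaughan2007, §15.1 Lemma 15.1 (Landau’s theorem for the Mellin transform of a non-negative function; applied to a bounded-below exponential sum)] -/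
theorem evenEngine_hasSum_transform [Countable ι] (hc : Summable fun i ↦ ‖c i‖) (hR : ∀ i, (lam i).re ≤ R)
    (hR0 : 0 ≤ R) (hreal : ∀ x : ℝ, 0 ≤ x → (∑' i, c i * cexp (lam i * x)).im = 0)
    {s : ℂ} (hs : R < s.re) :
    HasSum (fun i ↦ c i / (s - lam i))
      (Landau.mellinIoi (fun y : ℝ ↦ (∑' i, c i * cexp (lam i * ((Real.log (max y 1) : ℝ) : ℂ))).re + M) s
        - M / s) := by
  classical
  have hs0 : 0 < s.re := hR0.trans_lt hs
  have hsne : s ≠ 0 := fun h ↦ by rw [h, zero_re] at hs0; exact lt_irrefl _ hs0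
  -- the terms `G i`
  set G : ι → ℝ → ℂ := fun i y ↦ c i * (y : ℂ) ^ (lam i - (s + 1)) with hG
  have hGre : ∀ i, (lam i - (s + 1)).re < -1 := fun i ↦ by
    simp only [sub_re, add_re, one_re]; linarith [hR i]
  have hGint : ∀ i, Integrable (G i) (volume.restrict (Ioi 1)) := fun i ↦
    (integrableOn_Ioi_cpow_of_lt (hGre i) zero_lt_one).const_mul (c i)
  have hGval : ∀ i, ∫ y in Ioi (1 : ℝ), G i y = c i / (s - lam i) := by
    intro i
    have hne : s - lam i ≠ 0 := fun h ↦ by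
      have h' := congrArg re h
      simp only [sub_re, zero_re] at h'
      linarith [hR i]
    have hne' : lam i - (s + 1) + 1 ≠ 0 := by
      rw [show lam i - (s + 1) + 1 = -(s - lam i) by ring]; exact neg_ne_zero.2 hne
    simp only [hG]
    rw [integral_const_mul, evenEngine_integral_cpow (hGre i)]
    field_simp
    ring
  have hGnorm : ∀ i, ∫ y in Ioi (1 : ℝ), ‖G i y‖ = ‖c i‖ * (1 / (s.re - (lam i).re)) := by
    intro i
    have h1 : ∫ y in Ioi (1 : ℝ), ‖G i y‖ = ∫ y in Ioi (1 : ℝ), ‖c i‖ * y ^ ((lam i).re - s.re - 1) := by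
      refine setIntegral_congr_fun measurableSet_Ioi fun y hy ↦ ?_
      have hy0 : 0 < y := zero_lt_one.trans hy
      simp only [hG]
      rw [norm_mul, Complex.norm_cpow_eq_rpow_re_of_pos hy0]
      congr 2
      simp only [sub_re, add_re, one_re]
      ring
    have hlt : (lam i).re - s.re - 1 < -1 := by linarith [hR i]
    rw [h1, integral_const_mul, integral_Ioi_rpow_of_lt hlt zero_lt_one, Real.one_rpow]
    congr 1
    rw [show (lam i).re - s.re - 1 + 1 = -(s.re - (lam i).re) by ring, div_neg, neg_div, neg_neg]
  have hGsum : Summable fun i ↦ ∫ y in Ioi (1 : ℝ), ‖G i y‖ := by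
    refine Summable.of_nonneg_of_le (fun i ↦ integral_nonneg fun _ ↦ norm_nonneg _) (fun i ↦ ?_)
      (hc.mul_right (1 / (s.re - R)))
    rw [hGnorm i]
    have h1 : 0 < s.re - R := by linarith
    have h2 : s.re - R ≤ s.re - (lam i).re := by linarith [hR i]
    exact mul_le_mul_of_nonneg_left (one_div_le_one_div_of_le h1 h2) (norm_nonneg _)
  have key := hasSum_integral_of_summable_integral_norm hGint hGsum
  simp only [hGval] at key
  -- the term `H`
  set H : ℝ → ℂ := fun y ↦ (M : ℂ) * (y : ℂ) ^ (-(s + 1)) with hH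
  have hHre : (-(s + 1)).re < -1 := by simp only [neg_re, add_re, one_re]; linarith
  have hHint : Integrable H (volume.restrict (Ioi 1)) :=
    (integrableOn_Ioi_cpow_of_lt hHre zero_lt_one).const_mul (M : ℂ)
  have hHval : ∫ y in Ioi (1 : ℝ), H y = M / s := by
    have hne' : -(s + 1) + 1 ≠ 0 := by rw [show -(s + 1) + 1 = -s by ring]; exact neg_ne_zero.2 hsne
    simp only [hH]
    rw [integral_const_mul, evenEngine_integral_cpow hHre]
    field_simp
    ring
  -- the integrand of the transform
  set g : ℝ → ℝ := fun y ↦ (∑' i, c i * cexp (lam i * ((Real.log (max y 1) : ℝ) : ℂ))).re + M with hg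
  have hgm : Measurable g := (evenEngine_continuous_g hc hR hR0).measurable
  have hIint : Integrable (fun y : ℝ ↦ ((g y : ℝ) : ℂ) * (y : ℂ) ^ (-(s + 1)))
      (volume.restrict (Ioi 1)) := by
    have hσ : R < (R + s.re) / 2 := by linarith
    have h := Landau.integrable_mellinIntegrand hgm (evenEngine_hint hc hR hR0 hσ) 0
      (s := s) (by show (R + s.re) / 2 < s.re; linarith)
    refine h.congr (Eventually.of_forall fun y ↦ ?_)
    simp [Landau.mellinIntegrand]
  have hpt : ∀ y ∈ Ioi (1 : ℝ), ((g y : ℝ) : ℂ) * (y : ℂ) ^ (-(s + 1)) = (∑' i, G i y) + H y :=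
    fun y hy ↦ evenEngine_integrand_eq hreal hy s
  have hSint : Integrable (fun y ↦ ∑' i, G i y) (volume.restrict (Ioi 1)) := by
    refine (hIint.sub hHint).congr ?_
    filter_upwards [ae_restrict_mem measurableSet_Ioi] with y hy
    rw [Pi.sub_apply, hpt y hy]
    ring
  have hM' : Landau.mellinIoi g s = (∫ y in Ioi (1 : ℝ), ∑' i, G i y) + M / s := by
    rw [Landau.mellinIoi, ← hHval, ← integral_add hSint hHint]
    exact setIntegral_congr_fun measurableSet_Ioi hpt
  rw [hM', add_sub_cancel_right]
  exact key

/-- `s ↦ Σᵢ cᵢ/(s-λᵢ)` is holomorphic off the (closed) set of exponents (`M`-test on a small ball). [cite: MontgomeryVaughan2007, §15.1 Lemma 15.1 (Landau’s theorem for the Mellin transform of a non-negative function; applied to a bounded-below exponential sum)] -/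
theorem evenEngine_differentiableAt_fractions (hc : Summable fun i ↦ ‖c i‖)
    (hlf : ∀ z : ℂ, ∃ ε > 0, {i | lam i ∈ ball z ε}.Finite) {z : ℂ} (hz : ∀ i, lam i ≠ z) :
    DifferentiableAt ℂ (fun s ↦ ∑' i, c i / (s - lam i)) z := by
  have hclosed : IsClosed (lam '' Set.univ) := BoundedPowerSum.isClosed_image hlf _
  have hzmem : z ∈ (lam '' Set.univ)ᶜ := by rintro ⟨i, -, hi⟩; exact hz i hi
  obtain ⟨δ, hδ, hball⟩ := Metric.isOpen_iff.1 hclosed.isOpen_compl z hzmem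
  have hdist : ∀ s ∈ ball z (δ / 2), ∀ i, δ / 2 ≤ ‖s - lam i‖ := by
    intro s hs i
    by_contra h
    push Not at h
    have hmem : lam i ∈ ball z δ := by
      rw [mem_ball] at hs ⊢
      calc dist (lam i) z ≤ dist (lam i) s + dist s z := dist_triangle _ _ _
        _ < δ / 2 + δ / 2 := add_lt_add (by rw [dist_comm, dist_eq_norm]; exact h) hs
        _ = δ := by ring
    exact hball hmem ⟨i, Set.mem_univ _, rfl⟩
  have hd : DifferentiableOn ℂ (fun s ↦ ∑' i, c i / (s - lam i)) (ball z (δ / 2)) := by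
    refine differentiableOn_tsum_of_summable_norm (u := fun i ↦ ‖c i‖ * (2 / δ))
      (hc.mul_right _) (fun i ↦ ?_) isOpen_ball fun i s hs ↦ ?_
    · refine DifferentiableOn.div (differentiableOn_const _) (by fun_prop) fun s hs h0 ↦ ?_
      have h := hdist s hs i
      rw [h0, norm_zero] at h
      linarith
    · rw [norm_div]
      have hsi := hdist s hs i
      have hpos : 0 < ‖s - lam i‖ := by linarith
      rw [div_le_iff₀ hpos]
      calc ‖c i‖ = ‖c i‖ * (2 / δ) * (δ / 2) := by field_simp
        _ ≤ ‖c i‖ * (2 / δ) * ‖s - lam i‖ := by gcongr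
  exact hd.differentiableAt (isOpen_ball.mem_nhds (mem_ball_self (by positivity)))

/-- **Engine, analytic half.**  For a real exponential sum `F(x) = Σᵢ cᵢ e^{λᵢ x}` (`Σ‖cᵢ‖ < ∞`,
`Re λᵢ ≤ R`, `0 ≤ R`, `(λᵢ)` locally finite, no `λᵢ` on the open positive real axis) with `F ≥ -M` on `x ≥ 0`
there is `𝓜` (the Landau–Mellin transform of `y ↦ F(log y) + M ≥ 0`) holomorphic on the WHOLE half-plane
`Re s > 0` with `HasSum (cᵢ/(s-λᵢ)) (𝓜 s - M/s)` for `Re s > R`: Landau's theorem (tree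
`Landau.integrableOn_of_differentiableOn_union_convex`) with the continuation `Σᵢ cᵢ/(s-λᵢ) + M/s`, holomorphic
on `{Re s > R+1} ∪ W₀`, `W₀ = {0 < Re s < R+3, |Im s| < η}` free of exponents. [cite: MontgomeryVaughan2007, §15.1 Lemma 15.1 (Landau’s theorem for the Mellin transform of a non-negative function; applied to a bounded-below exponential sum)] -/
theorem stub_evenEngine_transform :
    ∀ (ι : Type) [Countable ι] (c lam : ι → ℂ) (R M : ℝ), 0 ≤ R →
      Summable (fun i => ‖c i‖) → (∀ i, (lam i).re ≤ R) →
      (∀ z : ℂ, ∃ ε > 0, {i | lam i ∈ Metric.ball z ε}.Finite) →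
      (∀ i, 0 < (lam i).re → (lam i).im ≠ 0) →
      (∀ x : ℝ, 0 ≤ x → (∑' i, c i * cexp (lam i * x)).im = 0) →
      (∀ x : ℝ, 0 ≤ x → -M ≤ (∑' i, c i * cexp (lam i * x)).re) →
      ∃ 𝓜 : ℂ → ℂ, DifferentiableOn ℂ 𝓜 {s : ℂ | 0 < s.re} ∧
        ∀ s : ℂ, R < s.re → HasSum (fun i => c i / (s - lam i)) (𝓜 s - M / s) := by
  intro ι _ c lam R M hR0 hc hR hlf hax hreal hM
  classical
  set g : ℝ → ℝ := fun y ↦ (∑' i, c i * cexp (lam i * ((Real.log (max y 1) : ℝ) : ℂ))).re + M with hg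
  refine ⟨Landau.mellinIoi g, ?_, fun s hs ↦ evenEngine_hasSum_transform hc hR hR0 hreal hs⟩
  have hgm : Measurable g := (evenEngine_continuous_g hc hR hR0).measurable
  set σ₁ : ℝ := R + 1 with hσ₁
  have hint := evenEngine_hint hc hR hR0 (M := M) (σ₁ := σ₁) (by rw [hσ₁]; linarith)
  -- finitely many exponents in the box `[0, σ₁+2] × [-1, 1]`; `η` below their ordinates
  set Kbox : Set ℂ := Icc (0 : ℝ) (σ₁ + 2) ×ℂ Icc (-1 : ℝ) 1 with hKbox
  have hKc : IsCompact Kbox := isCompact_Icc.reProdIm isCompact_Icc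
  have hfin : {i | lam i ∈ Kbox}.Finite := BoundedPowerSum.finite_preimage_of_isCompact hlf hKc
  set S : Finset ι := hfin.toFinset.filter (fun i ↦ 0 < (lam i).re) with hS
  set T : Finset ℝ := insert 1 (S.image fun i ↦ |(lam i).im|) with hT
  have hTne : T.Nonempty := Finset.insert_nonempty _ _
  set η : ℝ := T.min' hTne with hη
  have hη1 : η ≤ 1 := Finset.min'_le _ _ (Finset.mem_insert_self _ _)
  have hηpos : 0 < η := by
    rw [hη, Finset.lt_min'_iff]
    intro y hy
    rcases Finset.mem_insert.1 hy with rfl | hy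
    · exact one_pos
    · obtain ⟨i, hi, rfl⟩ := Finset.mem_image.1 hy
      exact abs_pos.2 (hax i (Finset.mem_filter.1 hi).2)
  have hηle : ∀ i, 0 < (lam i).re → (lam i).re ≤ σ₁ + 2 → |(lam i).im| ≤ 1 → η ≤ |(lam i).im| := by
    intro i h0 h1 h2
    apply Finset.min'_le
    refine Finset.mem_insert_of_mem (Finset.mem_image.2 ⟨i, ?_, rfl⟩)
    refine Finset.mem_filter.2 ⟨hfin.mem_toFinset.2 ?_, h0⟩
    show lam i ∈ Kbox
    rw [hKbox, Complex.mem_reProdIm]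
    exact ⟨⟨h0.le, h1⟩, abs_le.1 h2⟩
  -- the box `W₀`
  set W₀ : Set ℂ := {s : ℂ | 0 < s.re} ∩ {s : ℂ | s.re < σ₁ + 2} ∩ {s : ℂ | s.im < η} ∩
    {s : ℂ | -η < s.im} with hW₀
  have hW₀o : IsOpen W₀ :=
    (((isOpen_lt continuous_const Complex.continuous_re).inter
      (isOpen_lt Complex.continuous_re continuous_const)).inter
      (isOpen_lt Complex.continuous_im continuous_const)).inter
      (isOpen_lt continuous_const Complex.continuous_im)
  have hW₀c : Convex ℝ W₀ :=
    (((convex_halfSpace_re_gt 0).inter (convex_halfSpace_re_lt _)).inter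
      (convex_halfSpace_im_lt _)).inter (convex_halfSpace_im_gt _)
  have hW₀r : ∀ σ : ℝ, 0 < σ → σ ≤ σ₁ + 1 → (σ : ℂ) ∈ W₀ := by
    intro σ h0 h1
    simp only [hW₀, Set.mem_inter_iff, Set.mem_setOf_eq, ofReal_re, ofReal_im]
    exact ⟨⟨⟨h0, by linarith⟩, hηpos⟩, by linarith⟩
  -- no pole of the continuation on `{Re s > σ₁} ∪ W₀`
  have hgood : ∀ s ∈ ({s : ℂ | σ₁ < s.re} ∪ W₀), s ≠ 0 ∧ ∀ i, lam i ≠ s := by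
    intro s hs
    rcases hs with hs | hs
    · simp only [Set.mem_setOf_eq] at hs
      refine ⟨fun h ↦ ?_, fun i h ↦ ?_⟩
      · rw [h, zero_re] at hs; linarith
      · have := hR i; rw [h] at this; linarith
    · simp only [hW₀, Set.mem_inter_iff, Set.mem_setOf_eq] at hs
      obtain ⟨⟨⟨h0, h1⟩, h2⟩, h3⟩ := hs
      refine ⟨fun h ↦ ?_, fun i h ↦ ?_⟩
      · rw [h, zero_re] at h0; exact lt_irrefl _ h0
      · rw [← h] at h0 h1 h2 h3
        have habs : |(lam i).im| < η := abs_lt.2 ⟨h3, h2⟩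
        have := hηle i h0 h1.le (habs.le.trans hη1)
        linarith
  -- the continuation `Φ` and its holomorphy
  set Φ : ℂ → ℂ := fun s ↦ (∑' i, c i / (s - lam i)) + M / s with hΦ
  have hΦd : DifferentiableOn ℂ Φ ({s : ℂ | σ₁ < s.re} ∪ W₀) := by
    intro s hs
    obtain ⟨hs0, hsi⟩ := hgood s hs
    exact ((evenEngine_differentiableAt_fractions hc hlf hsi).add
      ((differentiableAt_const _).div differentiableAt_id hs0)).differentiableWithinAt
  have hagree : EqOn Φ (Landau.mellinIoi g) {s : ℂ | σ₁ < s.re} := by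
    intro s hs
    have hs' : R < s.re := by simp only [Set.mem_setOf_eq] at hs; linarith
    have h := (evenEngine_hasSum_transform hc hR hR0 hreal hs' (M := M)).tsum_eq
    simp only [hΦ]
    rw [h]
    ring
  -- Landau's theorem: absolute convergence, hence holomorphy, on `Re s > 0`
  have hconv : ∀ σ : ℝ, 0 < σ → IntegrableOn (fun y ↦ g y * y ^ (-(σ + 1))) (Ioi 1) := fun σ hσ ↦
    Landau.integrableOn_of_differentiableOn_union_convex hgm hint le_rfl
      (fun y _ ↦ evenEngine_g_nonneg hM y) (by rw [hσ₁]; linarith) hW₀o hW₀c hW₀r hΦd hagree hσ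
  exact Landau.differentiableOn_mellinIoi_of_forall hgm hconv

end Transform

end Literature.NumberTheory.LFunctions.WeilOddSector

end Part3

/-!
## Part 4 — port of `Summits/RiemannHypothesis/RiemannHypothesis/Theorems/RuelleBandExactFirstBandStubEvenEngine.lean` (1 declarations kept)

# The one-sided power-sum lemma: a real exponential sum bounded below has no mode of positive real part

`stub_evenEngine` (historical name kept): let `F(x) = Σᵢ cᵢ e^{λᵢ x}` with `Σ‖cᵢ‖ < ∞`, `Re λᵢ ≤ R`, `(λᵢ)` locally finite
and no `λᵢ` on the open positive real axis.  If `F` is real and `≥ −M` on `x ≥ 0`, then for every `μ` with `Re μ > 0` the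
coefficients on the fibre `{λᵢ = μ}` sum to `0`.  Proof: by the analytic half (previous Part) there is `𝓜` holomorphic on
`Re s > 0` with `𝓜(s) − M/s = Σᵢ cᵢ/(s − λᵢ)` for `Re s > R₀ := max R 0`; then the pole-clearing / identity-theorem step
of the tree's `BoundedPowerSum.sum_fiber_eq_zero` verbatim (on a thin convex neighbourhood of the segment
`[μ, R₀ + 2 + i Im μ]` the tail of the partial-fraction series is holomorphic, the finitely many poles on the segment are
cleared by a polynomial, and evaluating at `μ` gives `0 = (∏_{ν ≠ μ} (μ − ν)) · Σ_{λᵢ = μ} cᵢ`).  One-sidedness is paid for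
exactly by "no positive real mode".

References: [MontgomeryVaughan2007, §15.1 Lemma 15.1] (Landau); E. Bombieri, Rend. Lincei (9) 11 (2000), §3 Thm. 1 (the
two-sided bounded case, as used in the converse of Weil's criterion) [Bombieri2000Weil]; tree:
`Literature/Analysis/Complex/BoundedPowerSums.lean` [folklore].
-/

section Part4

open _root_.Complex _root_.Filter _root_.Set _root_.MeasureTheory _root_.Metric
open scoped _root_.Real _root_.Topology

namespace Literature.NumberTheory.LFunctions.WeilOddSector

open Literature.NumberTheory.LFunctions
open Literature.Analysis.Complex

/-- **The one-sided power-sum lemma (`stub_evenEngine`): a real exponential sum bounded below on `x ≥ 0`,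
with locally finite exponents none of which lies on the open positive real axis, has no mode of positive real
part** — the coefficients on every fibre `{λᵢ = μ}`, `Re μ > 0`, sum to zero.  Landau (previous Part) makes the
transform holomorphic on `Re s > 0`; then pole clearing and the identity theorem as in
`BoundedPowerSum.sum_fiber_eq_zero`. [cite: MontgomeryVaughan2007, §15.1 Lemma 15.1 (Landau) with Bombieri2000Weil, §3 Thm. 1 (proof: a power sum identity forces vanishing fibre sums; one-sided variant)] -/
theorem stub_evenEngine :
    ∀ (ι : Type) [Countable ι] (c lam : ι → ℂ) (R M : ℝ),
      Summable (fun i => ‖c i‖) → (∀ i, (lam i).re ≤ R) →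
      (∀ z : ℂ, ∃ ε > 0, {i | lam i ∈ Metric.ball z ε}.Finite) →
      (∀ i, 0 < (lam i).re → (lam i).im ≠ 0) →
      (∀ x : ℝ, 0 ≤ x → (∑' i, c i * cexp (lam i * x)).im = 0) →
      (∀ x : ℝ, 0 ≤ x → -M ≤ (∑' i, c i * cexp (lam i * x)).re) →
      ∀ μ : ℂ, 0 < μ.re → ∀ s : Finset ι, (∀ i, i ∈ s ↔ lam i = μ) → ∑ i ∈ s, c i = 0 := by
  intro ι _ c lam R' M hc hR' hlf hax hreal hM μ hμ s hs
  classical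
  -- normalise the abscissa bound to `R = max R' 0 ≥ 0`
  set R : ℝ := max R' 0 with hRdef
  have hR : ∀ i, (lam i).re ≤ R := fun i ↦ (hR' i).trans (le_max_left _ _)
  have hR0 : 0 ≤ R := le_max_right _ _
  -- the transform, holomorphic on `Re s > 0` (Landau), with its partial-fraction expansion on `Re s > R`
  obtain ⟨𝓜, h𝓜, hsum⟩ := stub_evenEngine_transform ι c lam R M hR0 hc hR hlf hax hreal hM
  -- trivial if the fibre is empty
  rcases s.eq_empty_or_nonempty with rfl | ⟨i₀, hi₀⟩
  · simp
  have hμi₀ : lam i₀ = μ := (hs i₀).1 hi₀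
  -- the segment `K = [μ, R + 2 + i Im μ]`
  set K : Set ℂ := {z | z.re ∈ Icc μ.re (R + 2) ∧ z.im = μ.im} with hK
  have hμR : μ.re ≤ R := hμi₀ ▸ hR i₀
  have hKc : IsCompact K := by
    have h : K = Icc μ.re (R + 2) ×ℂ {μ.im} := by
      ext z; simp [hK, Complex.mem_reProdIm]
    rw [h]
    exact isCompact_Icc.reProdIm isCompact_singleton
  have hKconv : Convex ℝ K := by
    have h : K = (Complex.reLm ⁻¹' Icc μ.re (R + 2)) ∩ (Complex.imLm ⁻¹' {μ.im}) := by
      ext z; simp [hK]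
    rw [h]
    exact ((convex_Icc _ _).linear_preimage _).inter ((convex_singleton _).linear_preimage _)
  have hμK : μ ∈ K := ⟨⟨le_rfl, by linarith⟩, rfl⟩
  set z₀ : ℂ := ⟨R + 2, μ.im⟩ with hz₀
  have hz₀K : z₀ ∈ K := ⟨⟨by simp [hz₀]; linarith, by simp [hz₀]⟩, by simp [hz₀]⟩
  have hz₀R : R < z₀.re := by simp [hz₀]
  -- indices with exponent on `K`: a finite set containing the fibre
  set I₀ : Finset ι := (BoundedPowerSum.finite_preimage_of_isCompact hlf hKc).toFinset with hI₀
  have hmemI₀ : ∀ i, i ∈ I₀ ↔ lam i ∈ K := fun i ↦ by simp [hI₀]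
  have hsI₀ : s ⊆ I₀ := fun i hi ↦ (hmemI₀ i).2 (((hs i).1 hi).symm ▸ hμK)
  have hi₀I₀ : i₀ ∈ I₀ := hsI₀ hi₀
  -- the other exponents stay away from `K`
  have hT : IsClosed (lam '' ((I₀ : Set ι)ᶜ)) := BoundedPowerSum.isClosed_image hlf _
  have hKT : K ⊆ (lam '' ((I₀ : Set ι)ᶜ))ᶜ := by
    rintro z hz ⟨i, hi, rfl⟩
    exact hi ((hmemI₀ i).2 hz)
  obtain ⟨δ₀, hδ₀, hthick⟩ := hKc.exists_thickening_subset_open hT.isOpen_compl hKT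
  set δ : ℝ := min δ₀ μ.re with hδdef
  have hδ : 0 < δ := lt_min hδ₀ hμ
  have hδ₀' : δ ≤ δ₀ := min_le_left _ _
  have hδμ : δ ≤ μ.re := min_le_right _ _
  -- the open convex neighbourhood `N` of `K`
  set N : Set ℂ := thickening (δ / 2) K with hN
  have hNo : IsOpen N := isOpen_thickening
  have hNconv : Convex ℝ N := hKconv.thickening _
  have hKN : K ⊆ N := self_subset_thickening (by positivity) K
  have hNre : ∀ z ∈ N, 0 < z.re := by
    intro z hz
    obtain ⟨k, hk, hzk⟩ := mem_thickening_iff.1 hz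
    have h1 : |z.re - k.re| < δ / 2 := by
      calc |z.re - k.re| = |(z - k).re| := by simp
        _ ≤ ‖z - k‖ := Complex.abs_re_le_norm _
        _ = dist z k := (dist_eq_norm z k).symm
        _ < δ / 2 := hzk
    have h2 : μ.re ≤ k.re := hk.1.1
    rw [abs_lt] at h1
    linarith
  have hNdist : ∀ z ∈ N, ∀ i, i ∉ I₀ → δ / 2 ≤ ‖z - lam i‖ := by
    intro z hz i hi
    obtain ⟨k, hk, hzk⟩ := mem_thickening_iff.1 hz
    have hfar : lam i ∉ thickening δ₀ K := fun h ↦ hthick h ⟨i, hi, rfl⟩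
    have h1 : δ₀ ≤ dist (lam i) k := by
      by_contra hlt
      exact hfar (mem_thickening_iff.2 ⟨k, hk, not_le.1 hlt⟩)
    have h2 : dist (lam i) k ≤ dist z (lam i) + dist z k := by
      rw [dist_comm z (lam i)]; exact dist_triangle _ _ _
    have h3 : dist z (lam i) = ‖z - lam i‖ := dist_eq_norm _ _
    linarith
  -- the tail `G₁` is holomorphic on `N`
  set G₁ : ℂ → ℂ := fun z ↦ ∑' i : ((I₀ : Set ι)ᶜ : Set ι), c i / (z - lam i) with hG₁
  have hG₁d : DifferentiableOn ℂ G₁ N := by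
    refine differentiableOn_tsum_of_summable_norm
      (u := fun i : ((I₀ : Set ι)ᶜ : Set ι) ↦ ‖c i‖ * (2 / δ))
      ((hc.subtype _).mul_right _) (fun i ↦ ?_) hNo fun i z hz ↦ ?_
    · refine DifferentiableOn.div (differentiableOn_const _) (by fun_prop) fun z hz h0 ↦ ?_
      have h := hNdist z hz i i.2
      rw [h0, norm_zero] at h
      linarith
    · rw [norm_div]
      have hzi := hNdist z hz i i.2
      have hpos : 0 < ‖z - lam i‖ := by linarith
      rw [div_le_iff₀ hpos]
      calc ‖c ↑i‖ = ‖c i‖ * (2 / δ) * (δ / 2) := by field_simp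
        _ ≤ ‖c i‖ * (2 / δ) * ‖z - lam ↑i‖ := by gcongr
  -- `Φ = 𝓜 - M/z - G₁` is holomorphic on `N`
  set Φ : ℂ → ℂ := fun z ↦ 𝓜 z - M / z - G₁ z with hΦ
  have hΦd : DifferentiableOn ℂ Φ N := by
    refine DifferentiableOn.sub (DifferentiableOn.sub (fun z hz ↦ ?_) (fun z hz ↦ ?_)) hG₁d
    · exact (h𝓜 z (hNre z hz)).mono_of_mem_nhdsWithin
        (mem_nhdsWithin_of_mem_nhds ((isOpen_lt continuous_const Complex.continuous_re).mem_nhds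
          (hNre z hz)))
    · exact ((differentiableAt_const _).div differentiableAt_id (fun h ↦ by
        have := hNre z hz; rw [h, zero_re] at this; exact lt_irrefl _ this)).differentiableWithinAt
  -- the polynomial `q` clearing the finitely many poles on `K`, and `P = q · (finite part)`
  set V : Finset ℂ := I₀.image lam with hV
  set q : ℂ → ℂ := fun z ↦ ∏ ν ∈ V, (z - ν) with hq
  set P : ℂ → ℂ := fun z ↦ ∑ i ∈ I₀, c i * ∏ ν ∈ V.erase (lam i), (z - ν) with hP
  have hqd : Differentiable ℂ q := by
    simp only [hq]
    fun_prop
  have hPd : Differentiable ℂ P := by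
    simp only [hP]
    fun_prop
  -- on `N ∩ {Re z > R}` we have `q Φ = P`
  have hEq : ∀ z ∈ N, R < z.re → q z * Φ z = P z := by
    intro z _ hzR
    have hne : ∀ i, z - lam i ≠ 0 := fun i h ↦ by
      have h' := congrArg Complex.re h
      simp only [sub_re, zero_re] at h'
      linarith [hR i]
    have h1 : Φ z = ∑ i ∈ I₀, c i / (z - lam i) := by
      simp only [hΦ, hG₁]
      rw [← (hsum z hzR).tsum_eq, ← (hsum z hzR).summable.sum_add_tsum_compl (s := I₀)]
      ring
    rw [h1, Finset.mul_sum]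
    refine Finset.sum_congr rfl fun i hi ↦ ?_
    have hiV : lam i ∈ V := Finset.mem_image_of_mem lam hi
    simp only [hq]
    rw [← Finset.mul_prod_erase V (fun ν ↦ z - ν) hiV, mul_assoc, mul_comm (z - lam i),
      mul_assoc, div_mul_cancel₀ _ (hne i), mul_comm]
  -- identity theorem on the convex open set `N`
  have hEqOn : EqOn (fun z ↦ q z * Φ z) P N := by
    refine ((hqd.differentiableOn.mul hΦd).analyticOnNhd hNo).eqOn_of_preconnected_of_eventuallyEq
      (hPd.differentiableOn.analyticOnNhd hNo) hNconv.isPreconnected (hKN hz₀K) ?_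
    filter_upwards [hNo.mem_nhds (hKN hz₀K),
      (isOpen_lt continuous_const Complex.continuous_re).mem_nhds hz₀R] with z hz hzR
    exact hEq z hz hzR
  -- evaluate at `μ`
  have hμV : μ ∈ V := hμi₀ ▸ Finset.mem_image_of_mem lam hi₀I₀
  have hqμ : q μ = 0 := by
    simp only [hq]
    exact Finset.prod_eq_zero hμV (sub_self μ)
  have hPμ : P μ = 0 := by
    rw [← hEqOn (hKN hμK)]
    simp only [hqμ, zero_mul]
  -- compute `P μ = D · ∑_{i ∈ s} cᵢ` with `D ≠ 0`
  set D : ℂ := ∏ ν ∈ V.erase μ, (μ - ν) with hD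
  have hD0 : D ≠ 0 :=
    Finset.prod_ne_zero_iff.2 fun ν hν ↦ sub_ne_zero.2 (Finset.ne_of_mem_erase hν).symm
  have hPμ' : P μ = D * ∑ i ∈ s, c i := by
    simp only [hP]
    rw [Finset.mul_sum, ← Finset.sum_subset hsI₀]
    · refine Finset.sum_congr rfl fun i hi ↦ ?_
      rw [(hs i).1 hi, mul_comm]
    · intro i _ his
      have hne : lam i ≠ μ := fun h ↦ his ((hs i).2 h)
      have hμVi : μ ∈ V.erase (lam i) := Finset.mem_erase.2 ⟨hne.symm, hμV⟩
      rw [Finset.prod_eq_zero hμVi (sub_self μ), mul_zero]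
  rw [hPμ', mul_eq_zero] at hPμ
  exact hPμ.resolve_left hD0

end Literature.NumberTheory.LFunctions.WeilOddSector

end Part4

/-!
## Part 5 — port of `Summits/RiemannHypothesis/RiemannHypothesis/Theorems/RuelleBandExactFirstBandStubEvenTestExists.lean` (2 declarations kept)

# An even real-valued test function with `ĝ(ρ) ≠ 0`

For every `ρ : ℂ` there is a smooth compactly supported `g : ℝ → ℂ` which is even, real-valued and has
`ĝ(ρ) = weilMellin g ρ ≠ 0` (`stub_evenTestExists`, historical name kept): `g = b`, a narrow non-negative `ContDiffBump`
at `0` of outer radius `δ = 1/(1 + |γ|)`, `γ = Im ρ`; on the support `|t| < δ` one has `cos(γ t) ≥ 0`, hence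
`Re ĝ(σ + iγ) = ∫ b(t) e^{(σ − 1/2)t} cos(γ t) dt > 0` for every real `σ` (`exists_even_real_isWeilTest_re_weilMellin_pos`;
the tree's `exists_isWeilTest_re_weilMellin_pos`, `WeilMellinBounds.lean`, with the two symmetries recorded).  This is
the first step of Yoshida's Lemma 1 ("we take `α₀ ∈ C_c^∞(ℝ)` so that `M(α₀)(ρ₀) = 1`").  Reference: H. Yoshida, *On
Hermitian forms attached to zeta functions*, Adv. Stud. Pure Math. 21 (1992), §1 Lemma 1 p. 285 [Yoshida1992HermitianForms].
-/

section Part5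

open _root_.Complex _root_.MeasureTheory _root_.Filter _root_.Set
open scoped _root_.Real _root_.Topology ComplexConjugate
namespace Literature.NumberTheory.LFunctions.WeilOddSector
open Literature.NumberTheory.LFunctions

/-- For every ordinate `γ` there is an **even, real-valued** test function `g` (a narrow non-negative
bump at `0`) with `Re ĝ(σ + iγ) > 0` for every real `σ`: on the support `|t| < 1/(1 + |γ|)` one has
`cos(γ t) ≥ 0`, with positivity at `t = 0`.  (The tree's `exists_isWeilTest_re_weilMellin_pos` with the
two symmetry conjuncts recorded.)
[cite: Yoshida1992HermitianForms, §1 Lemma 1 p. 285 (a test function α₀ ∈ C_c^∞(ℝ) with M(α₀)(ρ₀) ≠ 0; here even and real-valued)] -/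
theorem exists_even_real_isWeilTest_re_weilMellin_pos (γ : ℝ) :
    ∃ g : ℝ → ℂ, IsWeilTest g ∧ (∀ t : ℝ, g (-t) = g t) ∧ (∀ t : ℝ, (g t).im = 0) ∧
      ∀ σ : ℝ, 0 < (weilMellin g (σ + γ * I)).re := by
  -- adapted from Literature/NumberTheory/LFunctions/WeilMellinBounds.lean
  -- (`exists_isWeilTest_re_weilMellin_pos`)
  set δ : ℝ := 1 / (1 + |γ|) with hδ
  have hδpos : 0 < δ := by positivity
  let b : ContDiffBump (0 : ℝ) := ⟨δ / 2, δ, by positivity, by linarith⟩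
  refine ⟨fun t ↦ ((b t : ℝ) : ℂ), ⟨?_, ?_⟩, fun t ↦ ?_, fun t ↦ ?_, fun σ ↦ ?_⟩
  · exact Complex.ofRealCLM.contDiff.comp b.contDiff
  · exact b.hasCompactSupport.comp_left Complex.ofReal_zero
  · simp only [b.neg]
  · exact Complex.ofReal_im _
  · -- the integrand has real part `b(t) e^{(σ-1/2)t} cos(γ t) ≥ 0`, positive at `t = 0`
    set F : ℝ → ℝ := fun t ↦ b t * Real.exp ((σ - 1 / 2) * t) * Real.cos (γ * t) with hF
    have hint : Integrable fun t : ℝ ↦ ((b t : ℝ) : ℂ) * cexp ((σ + γ * I - 1 / 2) * t) :=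
      integrable_weilIntegrand (Complex.continuous_ofReal.comp b.continuous)
        (b.hasCompactSupport.comp_left Complex.ofReal_zero) _
    have hre : ∀ t : ℝ, (((b t : ℝ) : ℂ) * cexp ((σ + γ * I - 1 / 2) * t)).re = F t := by
      intro t
      rw [Complex.re_ofReal_mul, Complex.exp_re]
      have h1 : ((σ + γ * I - 1 / 2) * (t : ℂ)).re = (σ - 1 / 2) * t := by
        simp [sub_re, add_re, mul_re]
      have h2 : ((σ + γ * I - 1 / 2) * (t : ℂ)).im = γ * t := by
        simp [sub_im, add_im, mul_im]
      rw [h1, h2, hF]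
      ring
    unfold weilMellin
    have hI := integral_re hint
    simp only [RCLike.re_to_complex] at hI
    beta_reduce
    rw [← hI]
    simp_rw [hre]
    have hFc : Continuous F := by
      simp only [hF]
      have hb := b.continuous
      fun_prop
    have hFsupp : HasCompactSupport F := by
      simp only [hF]
      exact (b.hasCompactSupport.mul_right).mul_right
    have hFnn : 0 ≤ F := by
      intro t
      simp only [hF, Pi.zero_apply]
      by_cases ht : |t| < δ
      · refine mul_nonneg (mul_nonneg (b.nonneg' t) (Real.exp_pos _).le)
          (Real.cos_nonneg_of_mem_Icc ?_)
        have hγt : |γ * t| ≤ 1 := by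
          rw [abs_mul]
          calc |γ| * |t| ≤ |γ| * δ := mul_le_mul_of_nonneg_left ht.le (abs_nonneg _)
            _ = |γ| / (1 + |γ|) := by rw [hδ]; ring
            _ ≤ 1 := by rw [div_le_one (by positivity)]; linarith
        constructor <;> nlinarith [abs_le.1 hγt, Real.pi_gt_three]
      · have hb : b t = 0 := b.zero_of_le_dist (by simpa [Real.dist_eq] using not_lt.1 ht)
        simp [hb]
    have hF0 : F 0 ≠ 0 := by
      have hb0 : b 0 = 1 := b.one_of_mem_closedBall (by simp [b]; positivity)
      simp [hF, hb0]
    exact hFc.integral_pos_of_hasCompactSupport_nonneg_nonzero hFsupp hFnn hF0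

/-- **Stub 4 (S) — an even real test function seen by a given point.** For every `ρ` there is an
even, real-valued test function `g` with `ĝ(ρ) ≠ 0`: take the bump of
`exists_even_real_isWeilTest_re_weilMellin_pos (Im ρ)` and evaluate at `σ = Re ρ`, where
`Re ĝ(ρ) > 0` (`ρ = Re ρ + i Im ρ`, `Complex.re_add_im`).
[cite: Yoshida1992HermitianForms, §1 Lemma 1 p. 285 (a test function α₀ ∈ C_c^∞(ℝ) with M(α₀)(ρ₀) ≠ 0; here even and real-valued)] -/
theorem stub_evenTestExists :
    ∀ ρ : ℂ, ∃ g : ℝ → ℂ, IsWeilTest g ∧ (∀ t : ℝ, g (-t) = g t) ∧ (∀ t : ℝ, (g t).im = 0) ∧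
      weilMellin g ρ ≠ 0 := by
  intro ρ
  obtain ⟨g, hg, heven, hreal, hpos⟩ := exists_even_real_isWeilTest_re_weilMellin_pos ρ.im
  refine ⟨g, hg, heven, hreal, fun h ↦ ?_⟩
  have h1 := hpos ρ.re
  rw [Complex.re_add_im, h, Complex.zero_re] at h1
  exact lt_irrefl 0 h1

end Literature.NumberTheory.LFunctions.WeilOddSector

end Part5

/-!
## Part 6 — port of `Summits/RiemannHypothesis/RiemannHypothesis/Theorems/RuelleBandExactFirstBandStubEvenTransfer.lean` (1 declarations kept)

# The one-sided engine applied to the exponential series of a test function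

`stub_evenTransfer_order_mul_pairCoeff_eq_zero` (historical name kept): under the one-sided power-sum lemma (taken as a
HYPOTHESIS here, in the exact form proved in the Part above, so that this declaration is engine-agnostic), for a test
function `g` whose exponential series `B_g = WeilConverse.expSum g` is real with `Re B_g ≥ −Re Q₀(g)` on the real line,
`m(ρ₀) P_g(ρ₀) = 0` at every non-trivial zero `ρ₀` with `Re ρ₀ > 1/2`.  Index type: the non-trivial zeros (countable);
coefficients `c ρ = m(ρ) P_g(ρ)` (absolutely summable, `WeilConverse.summable_norm_pairCoeff`); exponents `λ ρ = ρ − 1/2`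
(`Re λ ≤ 1/2`, locally finite by `riemannZetaNontrivialZeros_finite_inter_ball`, `Im λ ρ = Im ρ ≠ 0` since `ζ(σ) ≠ 0` on
`(0,1)`, `riemannZetaNontrivialZeros.im_ne_zero`).  The even/odd-sector version of the bookkeeping of the tree's converse
Weil criterion (`WeilConverse.order_mul_pairCoeff_eq_zero`).  Reference: [Bombieri2000Weil, §3 Thm. 1 ("if" half)].
-/

section Part6

open _root_.Complex _root_.MeasureTheory _root_.Filter _root_.Set
open scoped _root_.Real _root_.Topology ComplexConjugate

namespace Literature.NumberTheory.LFunctions.WeilOddSector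

open Literature.NumberTheory.LFunctions

/-- **The engine applied to `B_g`.** Under the one-sided power-sum lemma (hypothesis `hE`), for a test function `g` whose
exponential sum `B_g` is real with `Re B_g ≥ -Re Q₀(g)` on the real line: `m(ρ₀) P_g(ρ₀) = 0` at every
non-trivial zero `ρ₀` with `Re ρ₀ > 1/2`.  Index type: the non-trivial zeros (countable); coefficients
`c ρ = m(ρ) P_g(ρ)` (absolutely summable, `WeilConverse.summable_norm_pairCoeff`); exponents
`λ ρ = ρ - 1/2` (`Re λ ≤ 1/2`, locally finite by `riemannZetaNontrivialZeros_finite_inter_ball`, and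
`Im λ ρ = Im ρ ≠ 0` since `ζ(σ) ≠ 0` on `(0,1)`, `riemannZetaNontrivialZeros.im_ne_zero`); the fibre of
`λ` over `ρ₀ - 1/2` is `{ρ₀}`. [cite: Bombieri2000Weil, §3 Thm. 1 (“if” half: positivity kills m(ρ)P_g(ρ) off the line; one-sided engine)] -/
theorem stub_evenTransfer_order_mul_pairCoeff_eq_zero
    (hE : ∀ (ι : Type) [Countable ι] (c lam : ι → ℂ) (R M : ℝ),
      Summable (fun i => ‖c i‖) → (∀ i, (lam i).re ≤ R) →
      (∀ z : ℂ, ∃ ε > 0, {i | lam i ∈ Metric.ball z ε}.Finite) →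
      (∀ i, 0 < (lam i).re → (lam i).im ≠ 0) →
      (∀ x : ℝ, 0 ≤ x → (∑' i, c i * cexp (lam i * x)).im = 0) →
      (∀ x : ℝ, 0 ≤ x → -M ≤ (∑' i, c i * cexp (lam i * x)).re) →
      ∀ μ : ℂ, 0 < μ.re → ∀ s : Finset ι, (∀ i, i ∈ s ↔ lam i = μ) → ∑ i ∈ s, c i = 0)
    {g : ℝ → ℂ} (hg : IsWeilTest g) (hBreal : ∀ x : ℝ, (WeilConverse.expSum g x).im = 0)
    (hbound : ∀ x : ℝ, -(WeilConverse.zeroForm g).re ≤ (WeilConverse.expSum g x).re)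
    {ρ₀ : ℂ} (hρ₀ : ρ₀ ∈ ZetaZeros.riemannZetaNontrivialZeros) (hre : 1 / 2 < ρ₀.re) :
    (riemannZetaZeroOrder ρ₀ : ℂ) * WeilConverse.pairCoeff g ρ₀ = 0 := by
  -- adapted from `WeilConverse.order_mul_pairCoeff_eq_zero` (Literature/…/WeilCriterionConverse.lean)
  have h := hE ZetaZeros.riemannZetaNontrivialZeros
    (fun ρ : ZetaZeros.riemannZetaNontrivialZeros ↦
      (riemannZetaZeroOrder (ρ : ℂ) : ℂ) * WeilConverse.pairCoeff g ρ)
    (fun ρ : ZetaZeros.riemannZetaNontrivialZeros ↦ (ρ : ℂ) - 1 / 2) (1 / 2)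
    (WeilConverse.zeroForm g).re (WeilConverse.summable_norm_pairCoeff hg)
    (fun ρ ↦ (le_abs_self _).trans (WeilConverse.abs_re_sub_half_le ρ.2)) (fun z ↦ ?_)
    (fun ρ _ ↦ by
      simpa [Complex.sub_im] using ZetaZeros.riemannZetaNontrivialZeros.im_ne_zero ρ.2)
    (fun x _ ↦ hBreal x) (fun x _ ↦ hbound x) (ρ₀ - 1 / 2)
    (by simp only [Complex.sub_re, Complex.div_ofNat_re, Complex.one_re]; linarith)
    {⟨ρ₀, hρ₀⟩} (fun ρ ↦ ?_)
  · simpa using h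
  · -- local finiteness of the exponents `ρ - 1/2`
    refine ⟨1, one_pos, ?_⟩
    refine ((riemannZetaNontrivialZeros_finite_inter_ball (z + 1 / 2) 1).preimage
      (Subtype.val_injective.injOn)).subset fun ρ hρ ↦ ?_
    simp only [mem_setOf_eq, Metric.mem_ball, dist_eq_norm] at hρ
    refine ⟨ρ.2, ?_⟩
    rw [Metric.mem_ball, dist_eq_norm]
    rwa [show (ρ : ℂ) - (z + 1 / 2) = (ρ : ℂ) - 1 / 2 - z by ring]
  · -- the fibre over `ρ₀ - 1/2` is `{ρ₀}`
    rw [Finset.mem_singleton, sub_left_inj]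
    constructor
    · rintro rfl; rfl
    · intro h; exact Subtype.ext h

end Literature.NumberTheory.LFunctions.WeilOddSector

end Part6

/-!
## Part 7 — port of `Summits/RiemannHypothesis/RiemannHypothesis/Theorems/RuelleBandExactFirstBandStubOddSectorCriterion.lean` (11 declarations kept)

# The odd-sector Weil criterion: positivity on odd real tests puts every non-real zero of the strip on the line

For an odd `g` (`g(−t) = −g(t)`), in the additive `1/2`-symmetric normalisation `ĝ(s) = ∫ g(t) e^{(s − 1/2)t} dt`:
* `ĝ(1 − s) = −ĝ(s)` (`weilMellin_one_sub_of_odd`), and for real-valued `g`, `conj ĝ(s) = ĝ(s̄)` (`conj_weilMellin_of_real`);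
  hence the zero-side coefficient is MINUS a square, `P_g(ρ) = −ĝ(ρ)²` (`pairCoeff_of_odd_real`), while still
  `P_g(1 − ρ) = P_g(ρ)` (`pairCoeff_one_sub_of_odd`), so `B_g` is again even and real (`expSum_neg_of_odd`, `expSum_im_of_odd`);
* the symmetric translate of an odd `g` is odd (`symTranslate_odd`), so odd-sector positivity applies to `h_{x/2}` and, via
  `Q₀(h_x) = (Re B_g(2x) + Q₀(g))/2` and `Q₀(h) = W(h ⋆ h̃)` (the PROVED explicit formula, `explicit_formula_holds`), gives the
  ONE-SIDED bound `Re B_g(x) ≥ −Re Q₀(g)` (`oddSector_lowerBound`);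
* the one-sided engine kills `m(ρ) P_g(ρ) = −m(ρ) ĝ(ρ)²` at every non-trivial zero with `Re ρ > 1/2`; zeros with `Re ρ < 1/2`
  reflect to `1 − ρ̄`, so `ĝ` vanishes at every off-line non-trivial zero for every odd real test `g`
  (`oddSector_weilMellin_eq_zero`);
* but for `ρ ≠ 1/2` the DERIVATIVE `g = g₀'` of the even real bump `g₀` of the previous Parts is an odd real test function with
  `ĝ(ρ) = −(ρ − 1/2) ĝ₀(ρ) ≠ 0` (`weilMellin_deriv`; `exists_odd_real_isWeilTest_weilMellin_ne_zero` — Yoshida, proof of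
  Lemma 1: `M(α₀‴)(s) = −(s − 1/2)³ M(α₀)(s)`).

Main theorem `stub_oddSectorCriterion` (historical name kept): `Re W(g ⋆ g̃) ≥ 0` for all odd real-valued tests `g` ⟹ every
zero of `ζ` with `0 < Re s < 1` has `Re s = 1/2` or `Im s = 0`.  This is the hard half of Yoshida 1992 Prop. 1(1) for
`k = ℚ` up to the real zeros, which `ζ` does not have on `(0,1)` (next Part).

References: H. Yoshida, *On Hermitian forms attached to zeta functions*, Adv. Stud. Pure Math. 21 (1992) 281–325, §1
Prop. 1(1) p. 285, proof pp. 286–287 [Yoshida1992HermitianForms]; E. Bombieri, Rend. Lincei (9) 11 (2000), §3 Thm. 1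
[Bombieri2000Weil]; A. Weil (1952) [Weil1952].
-/

section Part7

open _root_.Complex _root_.MeasureTheory _root_.Filter _root_.Set
open scoped _root_.Real _root_.Topology ComplexConjugate
namespace Literature.NumberTheory.LFunctions.WeilOddSector
open Literature.NumberTheory.LFunctions

/-- **Oddness of the transform.** For an odd `g`, `ĝ(1 - s) = -ĝ(s)` for every `s : ℂ`: substitute
`t ↦ -t` (`integral_neg_eq_self`) and use `g(-t) = -g(t)`, `(1 - s - 1/2)(-t) = (s - 1/2)t`.  No
hypotheses on `g` beyond oddness (both sides are junk together). [cite: Yoshida1992HermitianForms, §1 Prop. 1(1) p. 285 (proof pp. 286–287: oddly positive definite ⟹ every non-real non-trivial zero is on the critical line)] -/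
theorem weilMellin_one_sub_of_odd {g : ℝ → ℂ} (hodd : ∀ t : ℝ, g (-t) = -g t) (s : ℂ) :
    weilMellin g (1 - s) = -weilMellin g s := by
  -- adapted from `weilMellin_one_sub_of_even` (…StubEvenExpSum.lean)
  unfold weilMellin
  have h := integral_neg_eq_self
    (fun t : ℝ ↦ g (-t) * cexp ((1 - s - 1 / 2) * ((-t : ℝ) : ℂ))) volume
  simp only [neg_neg] at h
  rw [h, ← integral_neg]
  congr 1 with t
  rw [hodd t, neg_mul]
  congr 2
  push_cast
  ring

/-- **Realness of the transform.** For a real-valued `g`, `conj ĝ(s) = ĝ(conj s)` (conjugation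
commutes with the Bochner integral; `conj (g t) = g t`). [cite: Yoshida1992HermitianForms, §1 Prop. 1(1) p. 285 (proof pp. 286–287: oddly positive definite ⟹ every non-real non-trivial zero is on the critical line)] -/
theorem conj_weilMellin_of_real {g : ℝ → ℂ} (hreal : ∀ t : ℝ, (g t).im = 0) (s : ℂ) :
    conj (weilMellin g s) = weilMellin g (conj s) := by
  rw [weilMellin, weilMellin, ← integral_conj]
  refine integral_congr_ae (Eventually.of_forall fun t ↦ ?_)
  simp only [map_mul, ← Complex.exp_conj, map_sub, map_div₀, map_one, map_ofNat,
    Complex.conj_ofReal, Complex.conj_eq_iff_im.2 (hreal t)]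

/-- For an odd real-valued `g` the zero-side coefficient is MINUS a square:
`P_g(ρ) = ĝ(ρ) conj ĝ(1 - ρ̄) = ĝ(ρ) conj (-ĝ(ρ̄)) = -ĝ(ρ)²`. [cite: Yoshida1992HermitianForms, §1 Prop. 1(1) p. 285 (proof pp. 286–287: oddly positive definite ⟹ every non-real non-trivial zero is on the critical line)] -/
theorem pairCoeff_of_odd_real {g : ℝ → ℂ} (hodd : ∀ t : ℝ, g (-t) = -g t)
    (hreal : ∀ t : ℝ, (g t).im = 0) (ρ : ℂ) :
    WeilConverse.pairCoeff g ρ = -(weilMellin g ρ * weilMellin g ρ) := by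
  rw [WeilConverse.pairCoeff, weilMellin_one_sub_of_odd hodd, ← conj_weilMellin_of_real hreal, map_neg,
    Complex.conj_conj, mul_neg]

/-- **Reflection symmetry of the pairing, odd case.** For an odd `g`, `P_g(1 - ρ) = P_g(ρ)`:
both equal `-ĝ(ρ) conj ĝ(ρ̄)` by `weilMellin_one_sub_of_odd` (the two signs cancel). [cite: Yoshida1992HermitianForms, §1 Prop. 1(1) p. 285 (proof pp. 286–287: oddly positive definite ⟹ every non-real non-trivial zero is on the critical line)] -/
theorem pairCoeff_one_sub_of_odd {g : ℝ → ℂ} (hodd : ∀ t : ℝ, g (-t) = -g t) (ρ : ℂ) :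
    WeilConverse.pairCoeff g (1 - ρ) = WeilConverse.pairCoeff g ρ := by
  have h1 : 1 - conj (1 - ρ) = conj ρ := by simp
  rw [WeilConverse.pairCoeff, WeilConverse.pairCoeff, h1, weilMellin_one_sub_of_odd hodd ρ,
    weilMellin_one_sub_of_odd hodd (conj ρ), map_neg]
  ring

/-- **`B_g` is even for odd `g`.** Re-index `B_g(-y)` by the involution `ρ ↦ 1 - ρ` of the non-trivial
zeros (`one_sub_conj_mem` ∘ `conj_mem`; `Function.Involutive.toPerm`, `Equiv.tsum_eq`): multiplicities agree
(`riemannZetaZeroOrder_one_sub_holds`), the pairings agree (`pairCoeff_one_sub_of_odd`), and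
`((1-ρ) - 1/2)(-y) = (ρ - 1/2)y`. [cite: Yoshida1992HermitianForms, §1 Prop. 1(1) p. 285 (proof pp. 286–287: oddly positive definite ⟹ every non-real non-trivial zero is on the critical line)] -/
theorem expSum_neg_of_odd {g : ℝ → ℂ} (hodd : ∀ t : ℝ, g (-t) = -g t) (y : ℝ) :
    WeilConverse.expSum g (-y) = WeilConverse.expSum g y := by
  -- adapted from `expSum_neg_of_even` (…StubEvenExpSum.lean)
  have hinv : Function.Involutive fun ρ : ZetaZeros.riemannZetaNontrivialZeros ↦
      (⟨1 - (ρ : ℂ), by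
        simpa using ZetaZeros.riemannZetaNontrivialZeros.conj_mem
          (ZetaZeros.riemannZetaNontrivialZeros.one_sub_conj_mem ρ.2)⟩ :
        ZetaZeros.riemannZetaNontrivialZeros) :=
    fun ρ ↦ Subtype.ext (by simp)
  rw [WeilConverse.expSum, WeilConverse.expSum, ← Equiv.tsum_eq (hinv.toPerm _)]
  refine tsum_congr fun σ ↦ ?_
  have h0 := ZetaZeros.riemannZetaNontrivialZeros.re_pos σ.2
  have h1 := ZetaZeros.riemannZetaNontrivialZeros.re_lt_one σ.2
  have hm : riemannZetaZeroOrder (1 - (σ : ℂ)) = riemannZetaZeroOrder (σ : ℂ) :=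
    riemannZetaZeroOrder_one_sub_holds h0 h1
  have hE : cexp ((1 - (σ : ℂ) - 1 / 2) * ((-y : ℝ) : ℂ)) = cexp (((σ : ℂ) - 1 / 2) * (y : ℂ)) := by
    congr 1
    push_cast
    ring
  show (riemannZetaZeroOrder (1 - (σ : ℂ)) : ℂ) * WeilConverse.pairCoeff g (1 - (σ : ℂ)) *
      cexp ((1 - (σ : ℂ) - 1 / 2) * ((-y : ℝ) : ℂ)) = _
  rw [hm, pairCoeff_one_sub_of_odd hodd, hE]

/-- **`B_g` is real for odd `g`**: `conj B_g(y) = B_g(-y)` (`conj_expSum_eq_expSum_neg`, valid for every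
`g`) `= B_g(y)` (`expSum_neg_of_odd`). [cite: Yoshida1992HermitianForms, §1 Prop. 1(1) p. 285 (proof pp. 286–287: oddly positive definite ⟹ every non-real non-trivial zero is on the critical line)] -/
theorem expSum_im_of_odd {g : ℝ → ℂ} (hodd : ∀ t : ℝ, g (-t) = -g t) (y : ℝ) :
    (WeilConverse.expSum g y).im = 0 := by
  rw [← Complex.conj_eq_iff_im, conj_expSum_eq_expSum_neg, expSum_neg_of_odd hodd]

/-- The symmetric translate of an odd function is odd. [cite: Yoshida1992HermitianForms, §1 Prop. 1(1) p. 285 (proof pp. 286–287: oddly positive definite ⟹ every non-real non-trivial zero is on the critical line)] -/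
theorem symTranslate_odd {g : ℝ → ℂ} (hodd : ∀ t : ℝ, g (-t) = -g t) (x t : ℝ) :
    (g (-t - x) + g (-t + x)) / 2 = -((g (t - x) + g (t + x)) / 2) := by
  rw [show -t - x = -(t + x) by ring, show -t + x = -(t - x) by ring, hodd, hodd]
  ring

/-- **The one-sided bound, odd sector.** Under the odd-sector bet, for an odd real-valued test function
`g` and every real `x`: `-Re Q₀(g) ≤ Re B_g(x)`.  Indeed `h = h_{x/2}` is an odd real test function, so
`0 ≤ Re W(h ⋆ h̃) = Re Q₀(h) = (Re B_g(x) + Re Q₀(g))/2`, where `Q₀(h) = W(h ⋆ h̃)` because both are the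
limit of the symmetric partial zero sums of `h ⋆ h̃` (`WeilConverse.hasWeilZeroSide_zeroForm` and the
proved explicit formula `explicit_formula_holds`). [cite: Yoshida1992HermitianForms, §1 Prop. 1(1) p. 285 (proof pp. 286–287: oddly positive definite ⟹ every non-real non-trivial zero is on the critical line)] -/
theorem oddSector_lowerBound
    (hB : ∀ g : ℝ → ℂ, IsWeilTest g → (∀ t : ℝ, g (-t) = -g t) → (∀ t : ℝ, (g t).im = 0) →
      0 ≤ (weilQuadratic g).re)
    {g : ℝ → ℂ} (hg : IsWeilTest g) (hodd : ∀ t : ℝ, g (-t) = -g t)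
    (hreal : ∀ t : ℝ, (g t).im = 0) (x : ℝ) :
    -(WeilConverse.zeroForm g).re ≤ (WeilConverse.expSum g x).re := by
  -- adapted from `stub_evenTransfer_lowerBound` (…StubEvenTransfer.lean)
  have hh := isWeilTest_symTranslate hg (x / 2)
  have h0 := hB _ hh (fun t ↦ symTranslate_odd hodd (x / 2) t) (fun t ↦ symTranslate_im hreal (x / 2) t)
  -- `Q₀(h) = W(h ⋆ h̃)`
  have hQW : WeilConverse.zeroForm _ = weilQuadratic _ :=
    tendsto_nhds_unique (WeilConverse.hasWeilZeroSide_zeroForm hh)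
      (explicit_formula_holds (hh.weilConv hh.weilReflect))
  rw [← hQW, zeroForm_symTranslate hg, show 2 * (x / 2) = x by ring, Complex.div_ofNat_re,
    Complex.add_re, Complex.ofReal_re] at h0
  linarith

/-- **`ĝ` vanishes at every off-line non-trivial zero, for every odd real test `g`** (under the
odd-sector bet).  `B_g` is real (`expSum_im_of_odd`) with `Re B_g ≥ -Re Q₀(g)` (`oddSector_lowerBound`),
so THE ENGINE (`stub_evenEngine` via `stub_evenTransfer_order_mul_pairCoeff_eq_zero`) gives
`m(ρ) P_g(ρ) = 0` for `Re ρ > 1/2`; as `m(ρ) ≥ 1` and `P_g(ρ) = -ĝ(ρ)²`, `ĝ(ρ) = 0` there.  For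
`Re ρ < 1/2`, `1 - ρ̄` is a non-trivial zero with `Re > 1/2` and `ĝ(1 - ρ̄) = -conj ĝ(ρ)`. [cite: Yoshida1992HermitianForms, §1 Prop. 1(1) p. 285 (proof pp. 286–287: oddly positive definite ⟹ every non-real non-trivial zero is on the critical line)] -/
theorem oddSector_weilMellin_eq_zero
    (hB : ∀ g : ℝ → ℂ, IsWeilTest g → (∀ t : ℝ, g (-t) = -g t) → (∀ t : ℝ, (g t).im = 0) →
      0 ≤ (weilQuadratic g).re)
    {g : ℝ → ℂ} (hg : IsWeilTest g) (hodd : ∀ t : ℝ, g (-t) = -g t)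
    (hreal : ∀ t : ℝ, (g t).im = 0) {ρ : ℂ} (hρ : ρ ∈ ZetaZeros.riemannZetaNontrivialZeros)
    (hre : ρ.re ≠ 1 / 2) : weilMellin g ρ = 0 := by
  -- adapted from `stub_evenTransfer_weilMellin_eq_zero` (…StubEvenTransfer.lean)
  have hBreal : ∀ x : ℝ, (WeilConverse.expSum g x).im = 0 := fun x ↦ expSum_im_of_odd hodd x
  have hbound : ∀ x : ℝ, -(WeilConverse.zeroForm g).re ≤ (WeilConverse.expSum g x).re :=
    oddSector_lowerBound hB hg hodd hreal
  -- zeros to the right of the critical line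
  have key : ∀ ρ : ℂ, ρ ∈ ZetaZeros.riemannZetaNontrivialZeros → 1 / 2 < ρ.re →
      weilMellin g ρ = 0 := by
    intro ρ hρ hgt
    have h := stub_evenTransfer_order_mul_pairCoeff_eq_zero stub_evenEngine hg hBreal hbound hρ hgt
    have hm : (riemannZetaZeroOrder ρ : ℂ) ≠ 0 := by
      have := ZetaZeros.riemannZetaNontrivialZeros.one_le_order hρ
      exact_mod_cast (by omega : riemannZetaZeroOrder ρ ≠ 0)
    rw [pairCoeff_of_odd_real hodd hreal, mul_eq_zero, or_iff_right hm, neg_eq_zero] at h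
    exact mul_self_eq_zero.1 h
  rcases hre.lt_or_gt with hlt | hgt
  · -- zeros to the left reflect to the right: `ĝ(1 - ρ̄) = -conj ĝ(ρ) = 0`
    have h1 := key (1 - conj ρ) (ZetaZeros.riemannZetaNontrivialZeros.one_sub_conj_mem hρ)
      (by rw [WeilConverse.one_sub_conj_re]; linarith)
    rwa [weilMellin_one_sub_of_odd hodd, ← conj_weilMellin_of_real hreal, neg_eq_zero,
      map_eq_zero] at h1
  · exact key ρ hρ hgt

/-- **An odd real test function seen by a given point `ρ ≠ 1/2`.**  Take the even real-valued test
function `g₀` of `stub_evenTestExists ρ` (`ĝ₀(ρ) ≠ 0`) and differentiate: `g₀'` is a test function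
(`IsWeilTest.deriv`), odd (`deriv_comp_neg`), real-valued (`deriv.star`), and
`(g₀')^(ρ) = -(ρ - 1/2) ĝ₀(ρ) ≠ 0` (`weilMellin_deriv`). [cite: Yoshida1992HermitianForms, §1 Prop. 1(1) p. 285 (proof pp. 286–287: oddly positive definite ⟹ every non-real non-trivial zero is on the critical line)] -/
theorem exists_odd_real_isWeilTest_weilMellin_ne_zero {ρ : ℂ} (hρ : ρ ≠ 1 / 2) :
    ∃ g : ℝ → ℂ, IsWeilTest g ∧ (∀ t : ℝ, g (-t) = -g t) ∧ (∀ t : ℝ, (g t).im = 0) ∧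
      weilMellin g ρ ≠ 0 := by
  obtain ⟨g, hg, heven, hreal, hg0⟩ := stub_evenTestExists ρ
  refine ⟨deriv g, hg.deriv, fun t ↦ ?_, fun t ↦ ?_, ?_⟩
  · -- the derivative of an even function is odd
    have hfun : (fun x ↦ g (-x)) = g := funext heven
    have h := deriv_comp_neg g t
    rw [hfun] at h
    rw [h, neg_neg]
  · -- the derivative of a real-valued function is real-valued
    have hfun : (fun y ↦ star (g y)) = g := funext fun y ↦ Complex.conj_eq_iff_im.2 (hreal y)
    have h : deriv (fun y ↦ star (g y)) t = star (deriv g t) := deriv.star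
    rw [hfun] at h
    exact Complex.conj_eq_iff_im.1 h.symm
  · rw [weilMellin_deriv hg]
    exact mul_ne_zero (neg_ne_zero.2 (sub_ne_zero.2 hρ)) hg0

/-- **The odd-sector Weil criterion (`stub_oddSectorCriterion`).**  Weil positivity `0 ≤ Re W(g ⋆ g̃)` on the ODD real-valued test functions
⟹ every zero of `ζ` in the open critical strip lies on the critical line (or on the real axis).  Given a
zero `s` with `0 < Re s < 1` (a non-trivial zero, `mem_iff'`) and `Re s ≠ 1/2` (so `s ≠ 1/2`),
`exists_odd_real_isWeilTest_weilMellin_ne_zero` supplies an odd real test `g` with `ĝ(s) ≠ 0`,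
contradicting `oddSector_weilMellin_eq_zero`.
[cite: Yoshida1992HermitianForms, §1 Prop. 1(1) p. 285 (proof pp. 286–287: oddly positive definite ⟹ every non-real non-trivial zero is on the critical line)] -/
theorem stub_oddSectorCriterion :
    (∀ g : ℝ → ℂ, IsWeilTest g → (∀ t : ℝ, g (-t) = -g t) → (∀ t : ℝ, (g t).im = 0) → 0 ≤ (weilQuadratic g).re) →
    ∀ s : ℂ, riemannZeta s = 0 → 0 < s.re → s.re < 1 → s.re = 1 / 2 ∨ s.im = 0 := by
  intro hB s hs h0 h1
  have hmem : s ∈ ZetaZeros.riemannZetaNontrivialZeros :=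
    ZetaZeros.riemannZetaNontrivialZeros.mem_iff'.2 ⟨hs, h0, h1⟩
  refine Or.inl ?_
  by_contra hne
  have hs' : s ≠ 1 / 2 := by
    rintro rfl
    exact hne (by simp)
  obtain ⟨g, hg, hodd, hreal, hg0⟩ := exists_odd_real_isWeilTest_weilMellin_ne_zero hs'
  exact hg0 (oddSector_weilMellin_eq_zero hB hg hodd hreal hmem hne)

end Literature.NumberTheory.LFunctions.WeilOddSector

end Part7

/-!
## Part 8 — port of `Summits/RiemannHypothesis/RiemannHypothesis/Theorems/OddBartaFloor/Negative/OddBartaFloorLoadBearing.lean` (2 declarations kept)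

# Yoshida 1992 Prop. 1(1) for `k = ℚ`: odd-sector Weil positivity IS the Riemann hypothesis — `yoshida_odd_criterion` HOLDS

`oddPositivity_iff_riemannHypothesis`: `(∀ g odd test, Re W(g ⋆ g̃) ≥ 0) ↔ RiemannHypothesis`.  Hard half: the odd-sector
criterion of the previous Part (positivity on odd REAL tests suffices), `riemannZeta_ofReal_ne_zero_of_pos_of_lt_one`
(`ZetaRealAxis.lean`: no zeros on `(0,1)`) and the strip form of RH `riemannHypothesis_iff_strip_holds`
(`GeneralizedRH.lean`); easy half: `yoshida_odd_criterion_mp` (`YoshidaOddCriterion.lean`, from the easy half of Weil's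
criterion).  Hence the EXACT discharge `yoshida_odd_criterion_holds : yoshida_odd_criterion` of the named fact of
`Literature/NumberTheory/LFunctions/YoshidaOddCriterion.lean` (declared here directly under its exact name
`Literature.NumberTheory.LFunctions.yoshida_odd_criterion_holds`; in-tree original:
`Summit.RiemannHypothesis.RiemannHypothesis.Theorems.OddBartaFloor.Negative.yoshida_odd_criterion_holds`, same proof).

Reference: H. Yoshida, *On Hermitian forms attached to zeta functions*, in: Zeta Functions in Geometry, Adv. Stud. Pure
Math. 21 (1992) 281–325, §1 Prop. 1(1) p. 285 ("T_k is oddly positive definite if and only if R.H. holds for ζ_k(s)"),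
proof pp. 286–287 [Yoshida1992HermitianForms].  An EQUIVALENT reformulation of RH; RH itself is untouched.
-/

section Part8

open _root_.Filter _root_.Set _root_.MeasureTheory
open scoped _root_.Topology

namespace Literature.NumberTheory.LFunctions

open Literature.NumberTheory.LFunctions

/-! ## 1. Odd positivity is the Riemann hypothesis -/

/-- **Odd-sector Weil positivity IS the Riemann hypothesis (Yoshida 1992 Prop. 1(1), `k = ℚ`).** Hard
half: `WeilOddSector.stub_oddSectorCriterion` (positivity on odd REAL tests puts every zero with
`0 < Re s < 1` on the critical line or the real axis), `riemannZeta_ofReal_ne_zero_of_pos_of_lt_one`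
(no zeros on `(0,1)`) and the strip form `riemannHypothesis_iff_strip_holds`; easy half:
`yoshida_odd_criterion_mp`. [cite: Yoshida1992HermitianForms, §1 Prop. 1(1) p. 285] -/
theorem oddPositivity_iff_riemannHypothesis :
    (∀ g : ℝ → ℂ, IsWeilTest g → (∀ t : ℝ, g (-t) = -g t) → 0 ≤ (weilQuadratic g).re) ↔
      _root_.RiemannHypothesis := by
  constructor
  · intro hpos
    have hstrip := WeilOddSector.stub_oddSectorCriterion
      (fun g hg hodd _ ↦ hpos g hg hodd)
    refine riemannHypothesis_iff_strip_holds.2 fun s hs h0 h1 ↦ ?_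
    rcases hstrip s hs h0 h1 with h | him
    · exact h
    · exfalso
      have hsre : s = ((s.re : ℝ) : ℂ) := by
        apply Complex.ext <;> simp [him]
      rw [hsre] at hs
      exact riemannZeta_ofReal_ne_zero_of_pos_of_lt_one s.re h0 h1 hs
  · intro hRH g hg hodd
    exact yoshida_odd_criterion_mp hRH g hg hodd

/-- **The named fact `yoshida_odd_criterion` HOLDS** (`YoshidaOddCriterion.lean`; Yoshida 1992 Prop. 1(1) for `k = ℚ`:
`RiemannHypothesis ↔ Re W(g ⋆ g̃) ≥ 0` for every odd test `g`), EXACT discharge, both halves above.  A reformulation of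
RH; RH itself is untouched. [cite: Yoshida1992HermitianForms, §1 Prop. 1(1) p. 285] -/
theorem yoshida_odd_criterion_holds : yoshida_odd_criterion :=
  oddPositivity_iff_riemannHypothesis.symm

end Literature.NumberTheory.LFunctions

end Part8

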